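import Literature.Probability.Percolation.ArmSeparationOutKeysFour
import Literature.Probability.Percolation.ArmSeparationOutOrder
import HarnessLib

/-!
# Routing the four corridors of the outer landing: from the order certificate to a routed slot

Topic `Literature/Probability/Percolation`; family `crit-perc` / near-critical percolation on `𝕋`.
A brick of the near-critical arm-separation theorem for four arms of alternating colours
(P. Nolin, *Near-critical percolation in two dimensions*, EJP 13 (2008), Thm. 11 for `j = 4`,
`σ = BWBW` [arXiv 0711.4948: Thm. 10], landing step, §4.4 p. 12 with Prop. 12 (i)): the purely
combinatorial half of the covering lemma of the four-arm outer landing. From the *tip data* of a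
configuration of `OutMidTiny4` — frames, scales, windows and rows of the four fenced tips, of
alternating colours in the anticlockwise order of `∂Λ_{2M}` (the order certificate), with the row gaps
of fenced tips on a common frame — and target rows off the tips' danger zones (`exists_tgt`), this file
builds a slot `TipData.slot` of `ArmSeparationOutSlotsFour` (frames/scales/windows of the tips, target
choices, ring levels, arcs) and proves its routing predicate `Slot4.RouteOK` (`TipData.routeOK_slot`):
keys of tips and targets on the perimeter (`ArmSeparationOutKeysFour`), the cut and the reading order
(`Lanes.exists_cut`, here with the position of the cut: `Lanes.exists_cut'`), the levels
(`Lanes.laneLevel`, `Lanes.lanes_linear`), and on every ring road the hull of the arm's own tip window and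
target window read from the cut position, which the lanes lemma keeps off the spoke windows of the
other-colour arms of higher level and off the approach windows of those of lower level
(`RingObj.linPos_lt_of_cyc_lt`).

Everything here is proved; no named facts are introduced.

## References

* P. Nolin, Near-critical percolation in two dimensions, *Electron. J. Probab.* 13 (2008), §4.3
  Prop. 12 (i), Lemma 13, §4.4 (arXiv 0711.4948: Prop. 11, Lemma 12; proof of Thm. 10, p. 12) [Nolin2008].
* H. Kesten, Scaling relations for 2D-percolation, *Comm. Math. Phys.* 109 (1987), Lemmas 4–6 [Kesten1987].

Tree: `OParams`, `Slot4`, `Slot4.RouteOK`, `slot4Finset` (`ArmSeparationOutSlotsFour`), `frKey`,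
`RingObj` (`ArmSeparationOutKeysFour`), `Lanes.cyc/exists_cut/laneLevel/lanes_linear`, `SBtw`.
-/

namespace Literature.Probability.Percolation

open Lanes

/-! ### The cut, with its position -/

namespace Lanes

/-- **The cut, with its position** (`exists_cut` with the extra information that the cut is
`τ 0 - h` or `τ 0 + h` modulo `P`). [cite: Nolin2008, §4.3 Prop. 12 (i) and §4.4 p. 12 (arXiv 0711.4948: Prop. 11; relocation of landing areas)] -/
theorem exists_cut' {P h : ℤ} (hh : 1 ≤ h) {τ γ : Fin 4 → ℤ} (c₀ : Bool)
    (hτ : ∀ j, 0 ≤ τ j ∧ τ j < P) (hγ : ∀ k, 0 ≤ γ k ∧ γ k < P)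
    (hτcyc : cyc P (τ 0) (τ 1) < cyc P (τ 0) (τ 2) ∧ cyc P (τ 0) (τ 2) < cyc P (τ 0) (τ 3))
    (hγcyc : cyc P (γ 0) (γ 1) < cyc P (γ 0) (γ 2) ∧ cyc P (γ 0) (γ 2) < cyc P (γ 0) (γ 3))
    (hγ1 : 0 < cyc P (γ 0) (γ 1))
    (hsepτ : 2 * h ≤ cyc P (τ 0) (τ 1) ∧ cyc P (τ 0) (τ 3) ≤ P - 2 * h)
    (hsepγ : ∀ k, 2 * h ≤ cyc P (τ 0) (γ k) ∧ cyc P (τ 0) (γ k) ≤ P - 2 * h) :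
    ∃ c : ℤ, 0 ≤ c ∧ c < P ∧
      (c = (if h ≤ τ 0 then τ 0 - h else τ 0 - h + P) ∨ c = (if τ 0 + h < P then τ 0 + h else τ 0 + h - P)) ∧
      ∃ jt kt : Fin 4,
      (cyc P c (τ jt) < cyc P c (τ (jt + 1)) ∧ cyc P c (τ (jt + 1)) < cyc P c (τ (jt + 2)) ∧
        cyc P c (τ (jt + 2)) < cyc P c (τ (jt + 3))) ∧
      (cyc P c (γ kt) < cyc P c (γ (kt + 1)) ∧ cyc P c (γ (kt + 1)) < cyc P c (γ (kt + 2)) ∧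
        cyc P c (γ (kt + 2)) < cyc P c (γ (kt + 3))) ∧
      (∀ j, h ≤ cyc P c (τ j) ∧ cyc P c (τ j) ≤ P - h) ∧ (∀ k, h ≤ cyc P c (γ k) ∧ cyc P c (γ k) ≤ P - h) ∧
      (xor c₀ (decide ((jt : ℕ) % 2 = 1)) = decide ((kt : ℕ) % 2 = 0)) := by
  have hτ0 := hτ 0; have hτ1 := hτ 1; have hτ2 := hτ 2; have hτ3 := hτ 3
  have hγ0 := hγ 0; have hγ1' := hγ 1; have hγ2 := hγ 2; have hγ3 := hγ 3
  obtain ⟨kt, hkt⟩ := exists_first P (τ 0) γ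
  have hγne : ∀ k, γ k ≠ τ 0 := fun k heq => by
    have := (hsepγ k).1
    rw [heq, cyc_self] at this
    omega
  have hrot := rotate_cyclic (P := P) (b := τ 0) hγ hτ0 hγne hγcyc.1 hγcyc.2 hγ1 hkt
  have hP : 4 * h ≤ P := by have := (hsepγ 0).1; have := (hsepγ 0).2; omega
  set cm : ℤ := if h ≤ τ 0 then τ 0 - h else τ 0 - h + P with hcm
  set cp : ℤ := if τ 0 + h < P then τ 0 + h else τ 0 + h - P with hcp
  have hcm_range : 0 ≤ cm ∧ cm < P := by rw [hcm]; split_ifs <;> omega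
  have hcp_range : 0 ≤ cp ∧ cp < P := by rw [hcp]; split_ifs <;> omega
  have linm : ∀ x, 0 ≤ x → x < P → cyc P (τ 0) x ≤ P - 2 * h → cyc P cm x = cyc P (τ 0) x + h := by
    intro x hx hxP hd
    rw [hcm]; unfold cyc at hd ⊢; split_ifs at hd ⊢ <;> omega
  have linp : ∀ x, 0 ≤ x → x < P → 2 * h ≤ cyc P (τ 0) x → cyc P cp x = cyc P (τ 0) x - h := by
    intro x hx hxP hd
    rw [hcp]; unfold cyc at hd ⊢; split_ifs at hd ⊢ <;> omega
  have linm0 : cyc P cm (τ 0) = h := by rw [hcm]; unfold cyc; split_ifs <;> omega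
  have linp0 : cyc P cp (τ 0) = P - h := by rw [hcp]; unfold cyc; split_ifs <;> omega
  have hd1 : 2 * h ≤ cyc P (τ 0) (τ 1) ∧ cyc P (τ 0) (τ 1) ≤ P - 2 * h := ⟨hsepτ.1, by linarith [hτcyc.1, hτcyc.2, hsepτ.2]⟩
  have hd2 : 2 * h ≤ cyc P (τ 0) (τ 2) ∧ cyc P (τ 0) (τ 2) ≤ P - 2 * h := ⟨by linarith [hτcyc.1, hsepτ.1], by linarith [hτcyc.2, hsepτ.2]⟩
  have hd3 : 2 * h ≤ cyc P (τ 0) (τ 3) ∧ cyc P (τ 0) (τ 3) ≤ P - 2 * h := ⟨by linarith [hτcyc.1, hτcyc.2, hsepτ.1], hsepτ.2⟩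
  have tgtm : ∀ k, cyc P cm (γ k) = cyc P (τ 0) (γ k) + h := fun k => linm (γ k) (hγ k).1 (hγ k).2 (hsepγ k).2
  have tgtp : ∀ k, cyc P cp (γ k) = cyc P (τ 0) (γ k) - h := fun k => linp (γ k) (hγ k).1 (hγ k).2 (hsepγ k).1
  have tgt_orderm : cyc P cm (γ kt) < cyc P cm (γ (kt + 1)) ∧ cyc P cm (γ (kt + 1)) < cyc P cm (γ (kt + 2)) ∧
      cyc P cm (γ (kt + 2)) < cyc P cm (γ (kt + 3)) := by
    rw [tgtm, tgtm, tgtm, tgtm]; exact ⟨by linarith [hrot.1], by linarith [hrot.2.1], by linarith [hrot.2.2]⟩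
  have tgt_orderp : cyc P cp (γ kt) < cyc P cp (γ (kt + 1)) ∧ cyc P cp (γ (kt + 1)) < cyc P cp (γ (kt + 2)) ∧
      cyc P cp (γ (kt + 2)) < cyc P cp (γ (kt + 3)) := by
    rw [tgtp, tgtp, tgtp, tgtp]; exact ⟨by linarith [hrot.1], by linarith [hrot.2.1], by linarith [hrot.2.2]⟩
  have tgt_farm : ∀ k, h ≤ cyc P cm (γ k) ∧ cyc P cm (γ k) ≤ P - h := fun k => by
    rw [tgtm]; constructor <;> linarith [(hsepγ k).1, (hsepγ k).2]
  have tgt_farp : ∀ k, h ≤ cyc P cp (γ k) ∧ cyc P cp (γ k) ≤ P - h := fun k => by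
    rw [tgtp]; constructor <;> linarith [(hsepγ k).1, (hsepγ k).2]
  have tip_farm : ∀ j, h ≤ cyc P cm (τ j) ∧ cyc P cm (τ j) ≤ P - h := by
    intro j; fin_cases j
    · show h ≤ cyc P cm (τ 0) ∧ cyc P cm (τ 0) ≤ P - h; rw [linm0]; constructor <;> linarith
    · show h ≤ cyc P cm (τ 1) ∧ cyc P cm (τ 1) ≤ P - h
      rw [linm (τ 1) hτ1.1 hτ1.2 hd1.2]; constructor <;> linarith [hd1.1, hd1.2]
    · show h ≤ cyc P cm (τ 2) ∧ cyc P cm (τ 2) ≤ P - h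
      rw [linm (τ 2) hτ2.1 hτ2.2 hd2.2]; constructor <;> linarith [hd2.1, hd2.2]
    · show h ≤ cyc P cm (τ 3) ∧ cyc P cm (τ 3) ≤ P - h
      rw [linm (τ 3) hτ3.1 hτ3.2 hd3.2]; constructor <;> linarith [hd3.1, hd3.2]
  have tip_farp : ∀ j, h ≤ cyc P cp (τ j) ∧ cyc P cp (τ j) ≤ P - h := by
    intro j; fin_cases j
    · show h ≤ cyc P cp (τ 0) ∧ cyc P cp (τ 0) ≤ P - h; rw [linp0]; constructor <;> linarith
    · show h ≤ cyc P cp (τ 1) ∧ cyc P cp (τ 1) ≤ P - h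
      rw [linp (τ 1) hτ1.1 hτ1.2 hd1.1]; constructor <;> linarith [hd1.1, hd1.2]
    · show h ≤ cyc P cp (τ 2) ∧ cyc P cp (τ 2) ≤ P - h
      rw [linp (τ 2) hτ2.1 hτ2.2 hd2.1]; constructor <;> linarith [hd2.1, hd2.2]
    · show h ≤ cyc P cp (τ 3) ∧ cyc P cp (τ 3) ≤ P - h
      rw [linp (τ 3) hτ3.1 hτ3.2 hd3.1]; constructor <;> linarith [hd3.1, hd3.2]
  have tip_orderm : cyc P cm (τ 0) < cyc P cm (τ (0 + 1)) ∧ cyc P cm (τ (0 + 1)) < cyc P cm (τ (0 + 2)) ∧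
      cyc P cm (τ (0 + 2)) < cyc P cm (τ (0 + 3)) := by
    simp only [show (0 : Fin 4) + 1 = 1 from rfl, show (0 : Fin 4) + 2 = 2 from rfl, show (0 : Fin 4) + 3 = 3 from rfl]
    rw [linm0, linm (τ 1) hτ1.1 hτ1.2 hd1.2, linm (τ 2) hτ2.1 hτ2.2 hd2.2, linm (τ 3) hτ3.1 hτ3.2 hd3.2]
    exact ⟨by linarith [hd1.1], by linarith [hτcyc.1], by linarith [hτcyc.2]⟩
  have tip_orderp : cyc P cp (τ 1) < cyc P cp (τ (1 + 1)) ∧ cyc P cp (τ (1 + 1)) < cyc P cp (τ (1 + 2)) ∧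
      cyc P cp (τ (1 + 2)) < cyc P cp (τ (1 + 3)) := by
    simp only [show (1 : Fin 4) + 1 = 2 from rfl, show (1 : Fin 4) + 2 = 3 from rfl, show (1 : Fin 4) + 3 = 0 from rfl]
    rw [linp0, linp (τ 1) hτ1.1 hτ1.2 hd1.1, linp (τ 2) hτ2.1 hτ2.2 hd2.1, linp (τ 3) hτ3.1 hτ3.2 hd3.1]
    exact ⟨by linarith [hτcyc.1], by linarith [hτcyc.2], by linarith [hd3.2]⟩
  by_cases hpar : c₀ = decide ((kt : ℕ) % 2 = 0)
  · refine ⟨cm, hcm_range.1, hcm_range.2, Or.inl rfl, 0, kt, tip_orderm, tgt_orderm, tip_farm, tgt_farm, ?_⟩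
    have e : decide (((0 : Fin 4) : ℕ) % 2 = 1) = false := by decide
    rw [e, Bool.xor_false]
    exact hpar
  · refine ⟨cp, hcp_range.1, hcp_range.2, Or.inr rfl, 1, kt, tip_orderp, tgt_orderp, tip_farp, tgt_farp, ?_⟩
    have e : decide (((1 : Fin 4) : ℕ) % 2 = 1) = true := by decide
    rw [e, Bool.xor_true]
    cases c₀ <;> cases hk : decide ((kt : ℕ) % 2 = 0) <;> simp_all

/-- **Cyclic comparisons depend only on the order pattern**: if `(o, a, b)` and `(o', a', b')` (`a, b, a', b'`
in `[0, P)`) compare pairwise in the same way, then `cyc P o a < cyc P o b ↔ cyc P o' a' < cyc P o' b'`. [folklore] -/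
theorem cyc_lt_cyc_iff_of_iso {P o a b o' a' b' : ℤ} (ha : 0 ≤ a ∧ a < P) (hb : 0 ≤ b ∧ b < P)
    (ha' : 0 ≤ a' ∧ a' < P) (hb' : 0 ≤ b' ∧ b' < P)
    (h2 : a < o ↔ a' < o') (h3 : o < b ↔ o' < b') (h4 : b < o ↔ b' < o')
    (h5 : a < b ↔ a' < b') (h6 : b < a ↔ b' < a') :
    (cyc P o a < cyc P o b ↔ cyc P o' a' < cyc P o' b') := by
  unfold cyc; split_ifs <;> omega

/-- **Points far apart are cyclically far apart**: `x, y ∈ [0, P - m]` with `|x - y| ≥ m` are at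
anticlockwise distance in `[m, P - m]`. [folklore] -/
theorem cyc_far {P m x y : ℤ} (hx : 0 ≤ x) (hy : 0 ≤ y) (hxP : x + m ≤ P) (hyP : y + m ≤ P)
    (hxy : x + m ≤ y ∨ y + m ≤ x) : m ≤ cyc P x y ∧ cyc P x y ≤ P - m := by
  unfold cyc; split_ifs <;> omega

end Lanes

/-! ### Keys, continued -/

/-- **Orientation of a frame**: `-1` on the reflections `2, 5`, `+1` elsewhere. [folklore] -/
def orient (i : ℕ) : ℤ := if i % 3 = 2 then -1 else 1

/-- The orientation squares to one. [folklore] -/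
theorem orient_mul_orient (i : ℕ) : orient i * orient i = 1 := by unfold orient; split_ifs <;> norm_num

/-- **Keys are affine in the row** with slope `orient i`. [folklore] -/
theorem frKey_add {M i : ℕ} (hi : i < 6) (ξ δ : ℤ) : frKey M i (ξ + δ) = frKey M i ξ + orient i * δ := by
  interval_cases i <;> simp [frKey, orient] <;> ring

/-- **Keys of rows `m` inside the side lie `m` inside the block.** [folklore] -/
theorem frKey_bounds {M i : ℕ} (hi : i < 6) {ξ m : ℤ} (h1 : -(2 * (M : ℤ)) + m ≤ ξ) (h2 : ξ + m ≤ 0) :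
    2 * (M : ℤ) * i + m ≤ frKey M i ξ ∧ frKey M i ξ + m ≤ 2 * (M : ℤ) * (i + 1) := by
  interval_cases i <;>
    simp only [frKey_zero, frKey_one, frKey_two, frKey_three, frKey_four, frKey_five, Nat.cast_zero, Nat.cast_one, Nat.cast_ofNat] <;>
    constructor <;> linarith

/-- **Keys of different frames compare as the frames** (rows inside the sides). [folklore] -/
theorem frKey_lt_frKey_iff_of_ne {M i i' : ℕ} (hi : i < 6) (hi' : i' < 6) (hne : i ≠ i') {ξ ξ' : ℤ}
    (h1 : -(2 * (M : ℤ)) < ξ) (h2 : ξ < 0) (h1' : -(2 * (M : ℤ)) < ξ') (h2' : ξ' < 0) :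
    (frKey M i ξ < frKey M i' ξ' ↔ i < i') := by
  have b := frKey_mem_block (M := M) hi h1 h2
  have b' := frKey_mem_block (M := M) hi' h1' h2'
  have hM : (0 : ℤ) ≤ M := by positivity
  constructor
  · intro h
    by_contra hle; push Not at hle
    have hlt : i' < i := lt_of_le_of_ne hle (Ne.symm hne)
    have : (i' : ℤ) + 1 ≤ i := by exact_mod_cast hlt
    nlinarith [b.1, b'.2]
  · intro h
    have : (i : ℤ) + 1 ≤ i' := by exact_mod_cast h
    nlinarith [b.2, b'.1]

/-! ### Tip data -/

/-- **The tip data of a configuration of `OutMidTiny4`**: for the four fenced tips in the anticlockwise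
order of `∂Λ_{2M}` (colours open, closed, open, closed for `a = 0, 1, 2, 3`): the frame `i a`, the scale
index `j a`, the index `ν a` of the window holding the tip row, and the tip row `ζ a`. [folklore] -/
structure TipData where
  /-- frames -/
  i : Fin 4 → ℕ
  /-- scale indices -/
  j : Fin 4 → ℕ
  /-- window indices -/
  ν : Fin 4 → ℕ
  /-- tip rows -/
  ζ : Fin 4 → ℤ

namespace TipData

variable (P : OParams) (D : TipData) (tc : Fin 4 → ℕ)

/-- window start of the tip `a` [folklore] -/
def T (a : Fin 4) : ℤ := P.T₀ (D.ν a)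
/-- scale of the tip `a` [folklore] -/
def k (a : Fin 4) : ℕ := trapScale P.k₀ (D.j a)
/-- spoke row of the tip `a` [folklore] -/
def ξ (a : Fin 4) : ℤ := D.T P a + 2 * D.k P a + P.w
/-- spoke key of the tip `a` [folklore] -/
def κ (a : Fin 4) : ℤ := frKey P.M (D.i a) (D.ξ P a)
/-- tip key of the tip `a` (the perimeter coordinate of the framed tip) [folklore] -/
def κz (a : Fin 4) : ℤ := frKey P.M (D.i a) (D.ζ a)
/-- target row of the landing side `e` (sides `0, 2, 3, 5` for `e = 0, 1, 2, 3`) for the choices `tc` [folklore] -/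
def t (e : Fin 4) : ℤ := P.tgtRow4 (tc e)
/-- target key of the landing side `e` [folklore] -/
def γ (e : Fin 4) : ℤ := frKey P.M (Slot4.ts e) (t P tc e)

/-- **Good tip data** (what `OutMidTiny4` provides, besides the order certificate): ranges, the tip row
in its window and in the middle of its side, the row gap of fenced tips of different colours on a common
frame (`row_gap_of_lt`), and for two tips of the same colour on a common frame a tip of the other colour on
that frame strictly between them (the order certificate read through `frame_eq_and_row_sbtw`). [folklore] -/
structure Good : Prop where
  /-- frames -/
  hi : ∀ a, D.i a < 6
  /-- scale indices -/
  hj : ∀ a, D.j a < P.K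
  /-- windows -/
  hν : ∀ a, D.ν a < P.Nw
  /-- the tip row lies in its window -/
  hζ : ∀ a, D.T P a ≤ D.ζ a ∧ D.ζ a < D.T P a + P.w
  /-- middle tips -/
  hgood : ∀ a, -(2 * (P.M : ℤ)) + P.R₀ ≤ D.ζ a ∧ D.ζ a ≤ -(P.R₀ : ℤ)
  /-- different colours on a common frame: row gap -/
  hdiff : ∀ a b : Fin 4, (a : ℕ) % 2 ≠ (b : ℕ) % 2 → D.i a = D.i b → D.ζ a + 8 * D.k P a < D.ζ b ∨ D.ζ b + 8 * D.k P b < D.ζ a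
  /-- open tips on a common frame: a closed tip between -/
  hsame02 : D.i 0 = D.i 2 → ∃ c : Fin 4, (c : ℕ) % 2 = 1 ∧ D.i c = D.i 0 ∧ SBtw (D.ζ 0) (D.ζ c) (D.ζ 2)
  /-- closed tips on a common frame: an open tip between -/
  hsame13 : D.i 1 = D.i 3 → ∃ c : Fin 4, (c : ℕ) % 2 = 0 ∧ D.i c = D.i 1 ∧ SBtw (D.ζ 1) (D.ζ c) (D.ζ 3)

/-- **Targets off the danger zones**: the target row of the side `e` is more than `μ + 8s` below, or its
approach rows end more than `μ + 8s` below, the spoke row of every tip of the frame `ts e`. [folklore] -/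
structure TgtOK : Prop where
  /-- every tip of the landing side is off the danger zone of the target -/
  out : ∀ e a, D.i a = Slot4.ts e → D.ξ P a + P.μ + 8 * P.s < t P tc e ∨ t P tc e + (P.N' / 64 : ℕ) + P.μ + 8 * P.s < D.ξ P a

variable {P D tc}

/-- **Numeric facts of good tip data** in a valid rung. [folklore] -/
theorem Good.facts (hV : P.Valid) (hD : D.Good P) (a : Fin 4) :
    (P.k₀ : ℤ) ≤ D.k P a ∧ 32 * (D.k P a : ℤ) ≤ P.μ ∧ D.ξ P a = D.T P a + 2 * D.k P a + P.w ∧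
      D.T P a ≤ D.ζ a ∧ D.ζ a < D.T P a + P.w ∧ -(2 * (P.M : ℤ)) + P.R₀ ≤ D.ζ a ∧ D.ζ a ≤ -(P.R₀ : ℤ) ∧
      -(2 * (P.M : ℤ)) + 7 * P.s ≤ D.ξ P a ∧ D.ξ P a + 7 * P.s < 0 ∧ -(2 * (P.M : ℤ)) < D.ζ a ∧ D.ζ a < 0 := by
  obtain ⟨hs, hk₀, hμ, hw1, hw2, -, -, -, -, -, -, -, -, -, -, -, -, -, -, hμM, hR₀, hR₀M, -, -⟩ := hV.ifacts
  have hk1 : (P.k₀ : ℤ) ≤ D.k P a := by exact_mod_cast le_trapScale P.k₀ (D.j a)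
  have hk2 : 32 * (D.k P a : ℤ) ≤ P.μ := by exact_mod_cast P.scale_le (hD.hj a)
  obtain ⟨z1, z2⟩ := hD.hζ a
  obtain ⟨g1, g2⟩ := hD.hgood a
  have hξ : D.ξ P a = D.T P a + 2 * D.k P a + P.w := rfl
  refine ⟨hk1, hk2, hξ, z1, z2, g1, g2, ?_, ?_, ?_, ?_⟩ <;> omega

/-- **Row gap of tips of different colours on a common frame**, in the three forms used: the spoke rows
differ by more than seven chunks, and the windows are as far apart as `RouteOK` (h) demands. [folklore] -/
theorem Good.gap_of_diff (hV : P.Valid) (hD : D.Good P) {a b : Fin 4} (hpar : (a : ℕ) % 2 ≠ (b : ℕ) % 2)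
    (hi : D.i a = D.i b) (hlt : D.ζ a < D.ζ b) :
    D.ξ P a + 7 * P.s < D.ξ P b ∧ D.T P a + 8 * D.k P a < D.T P b + P.w := by
  obtain ⟨ka1, -, hξa, za1, za2, -⟩ := hD.facts hV a
  obtain ⟨kb1, -, hξb, zb1, zb2, -⟩ := hD.facts hV b
  obtain ⟨hs, hk₀, -, hw1, -⟩ := hV.ifacts
  have hk0 : (0 : ℤ) ≤ D.k P b := by positivity
  rcases hD.hdiff a b hpar hi with h | h
  · constructor <;> nlinarith
  · nlinarith

/-- **Two distinct tips on a common frame, the first below the second: the spoke rows differ by more than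
seven chunks** (different colours: the row gap; the same colour: through the tip between). [folklore] -/
theorem Good.gap (hV : P.Valid) (hD : D.Good P) {a b : Fin 4} (hab : a ≠ b) (hi : D.i a = D.i b) (hlt : D.ζ a < D.ζ b) :
    D.ξ P a + 7 * P.s < D.ξ P b := by
  by_cases hpar : (a : ℕ) % 2 ≠ (b : ℕ) % 2
  · exact (hD.gap_of_diff hV hpar hi hlt).1
  · push Not at hpar
    have hs0 : (0 : ℤ) ≤ P.s := by positivity
    -- same colour: `{a, b} = {0, 2}` or `{1, 3}`
    have key : ∀ {x y : Fin 4} (c : Fin 4), (c : ℕ) % 2 ≠ (x : ℕ) % 2 → (x : ℕ) % 2 = (y : ℕ) % 2 → D.i c = D.i x →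
        D.i x = D.i y → SBtw (D.ζ x) (D.ζ c) (D.ζ y) → D.ζ x < D.ζ y → D.ξ P x + 7 * P.s < D.ξ P y := by
      intro x y c hcx hxy hic hixy hb hxy'
      rcases hb with ⟨b1, b2⟩ | ⟨b1, b2⟩
      · have g1 := (hD.gap_of_diff hV (Ne.symm hcx) hic.symm b1).1
        have g2 := (hD.gap_of_diff hV (by omega) (hic.trans hixy) b2).1
        linarith
      · exfalso; linarith
    have ha := a.isLt; have hb := b.isLt
    have hab' : (a : ℕ) ≠ b := fun h => hab (Fin.ext h)
    have h4 : ((a : ℕ) = 0 ∧ (b : ℕ) = 2) ∨ ((a : ℕ) = 2 ∧ (b : ℕ) = 0) ∨ ((a : ℕ) = 1 ∧ (b : ℕ) = 3) ∨ ((a : ℕ) = 3 ∧ (b : ℕ) = 1) := by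
      omega
    rcases h4 with ⟨ha0, hb0⟩ | ⟨ha0, hb0⟩ | ⟨ha0, hb0⟩ | ⟨ha0, hb0⟩
    · have ea : a = 0 := Fin.ext ha0; have eb : b = 2 := Fin.ext hb0
      subst ea; subst eb
      obtain ⟨c, hc1, hc2, hc3⟩ := hD.hsame02 hi
      exact key c (by simp [hc1]) (by decide) hc2 hi hc3 hlt
    · have ea : a = 2 := Fin.ext ha0; have eb : b = 0 := Fin.ext hb0
      subst ea; subst eb
      obtain ⟨c, hc1, hc2, hc3⟩ := hD.hsame02 hi.symm
      refine key c (by simp [hc1]) (by decide) (hc2.trans hi.symm) hi ?_ hlt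
      unfold SBtw at hc3 ⊢; tauto
    · have ea : a = 1 := Fin.ext ha0; have eb : b = 3 := Fin.ext hb0
      subst ea; subst eb
      obtain ⟨c, hc1, hc2, hc3⟩ := hD.hsame13 hi
      exact key c (by simp [hc1]) (by decide) hc2 hi hc3 hlt
    · have ea : a = 3 := Fin.ext ha0; have eb : b = 1 := Fin.ext hb0
      subst ea; subst eb
      obtain ⟨c, hc1, hc2, hc3⟩ := hD.hsame13 hi.symm
      refine key c (by simp [hc1]) (by decide) (hc2.trans hi.symm) hi ?_ hlt
      unfold SBtw at hc3 ⊢; tauto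

/-- **Distinct tips on a common frame have distinct rows.** [folklore] -/
theorem Good.zeta_ne (hV : P.Valid) (hD : D.Good P) {a b : Fin 4} (hab : a ≠ b) (hi : D.i a = D.i b) : D.ζ a ≠ D.ζ b := by
  intro heq
  by_cases hpar : (a : ℕ) % 2 ≠ (b : ℕ) % 2
  · have hk0 : (0 : ℤ) < D.k P a := by have := (hD.facts hV a).1; have := hV.ifacts.2.1; linarith
    have hk0' : (0 : ℤ) < D.k P b := by have := (hD.facts hV b).1; have := hV.ifacts.2.1; linarith
    rcases hD.hdiff a b hpar hi with h | h <;> linarith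
  · push Not at hpar
    have ha := a.isLt; have hb := b.isLt
    have hab' : (a : ℕ) ≠ b := fun h => hab (Fin.ext h)
    have h4 : ((a : ℕ) = 0 ∧ (b : ℕ) = 2) ∨ ((a : ℕ) = 2 ∧ (b : ℕ) = 0) ∨ ((a : ℕ) = 1 ∧ (b : ℕ) = 3) ∨ ((a : ℕ) = 3 ∧ (b : ℕ) = 1) := by
      omega
    rcases h4 with ⟨ha0, hb0⟩ | ⟨ha0, hb0⟩ | ⟨ha0, hb0⟩ | ⟨ha0, hb0⟩
    · have ea : a = 0 := Fin.ext ha0; have eb : b = 2 := Fin.ext hb0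
      subst ea; subst eb
      obtain ⟨c, -, -, hc3⟩ := hD.hsame02 hi; unfold SBtw at hc3; omega
    · have ea : a = 2 := Fin.ext ha0; have eb : b = 0 := Fin.ext hb0
      subst ea; subst eb
      obtain ⟨c, -, -, hc3⟩ := hD.hsame02 hi.symm; unfold SBtw at hc3; omega
    · have ea : a = 1 := Fin.ext ha0; have eb : b = 3 := Fin.ext hb0
      subst ea; subst eb
      obtain ⟨c, -, -, hc3⟩ := hD.hsame13 hi; unfold SBtw at hc3; omega
    · have ea : a = 3 := Fin.ext ha0; have eb : b = 1 := Fin.ext hb0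
      subst ea; subst eb
      obtain ⟨c, -, -, hc3⟩ := hD.hsame13 hi.symm; unfold SBtw at hc3; omega

/-- **Tip rows and spoke rows of distinct tips on a common frame compare alike.** [folklore] -/
theorem Good.zeta_lt_iff (hV : P.Valid) (hD : D.Good P) {a b : Fin 4} (hab : a ≠ b) (hi : D.i a = D.i b) :
    (D.ζ a < D.ζ b ↔ D.ξ P a < D.ξ P b) := by
  have hs0 : (0 : ℤ) ≤ P.s := by positivity
  constructor
  · intro h; linarith [hD.gap hV hab hi h]
  · intro h
    rcases lt_trichotomy (D.ζ a) (D.ζ b) with h' | h' | h'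
    · exact h'
    · exact absurd h' (hD.zeta_ne hV hab hi)
    · linarith [hD.gap hV (Ne.symm hab) hi.symm h']

/-- **Tip keys and spoke keys compare alike** (pairwise order isomorphism of the two families of keys). [folklore] -/
theorem Good.κz_lt_iff (hV : P.Valid) (hD : D.Good P) {a b : Fin 4} (hab : a ≠ b) :
    (D.κz P a < D.κz P b ↔ D.κ P a < D.κ P b) := by
  obtain ⟨-, -, -, -, -, -, -, xa1, xa2, za1, za2⟩ := hD.facts hV a
  obtain ⟨-, -, -, -, -, -, -, xb1, xb2, zb1, zb2⟩ := hD.facts hV b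
  have hs1 : (1 : ℤ) ≤ P.s := by have := hV.ifacts.1; have := hV.ifacts.2.1; linarith
  have hia := hD.hi a; have hib := hD.hi b
  unfold κz κ
  by_cases hi : D.i a = D.i b
  · rw [← hi, frKey_lt_frKey_iff (M := P.M) hia, frKey_lt_frKey_iff (M := P.M) hia, hD.zeta_lt_iff hV hab hi,
      hD.zeta_lt_iff hV (Ne.symm hab) hi.symm]
  · rw [frKey_lt_frKey_iff_of_ne hia hib hi za1 za2 zb1 zb2,
      frKey_lt_frKey_iff_of_ne hia hib hi (by linarith) (by linarith) (by linarith) (by linarith)]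

/-- **Spoke keys lie seven chunks inside their blocks.** [folklore] -/
theorem Good.κ_mem (hV : P.Valid) (hD : D.Good P) (a : Fin 4) :
    2 * (P.M : ℤ) * (D.i a) + 7 * P.s ≤ D.κ P a ∧ D.κ P a + 7 * P.s ≤ 2 * (P.M : ℤ) * (D.i a + 1) := by
  obtain ⟨-, -, -, -, -, -, -, xa1, xa2, -⟩ := hD.facts hV a
  exact frKey_bounds (hD.hi a) xa1 xa2.le

/-- **Spoke keys lie in `[0, 12M)`** with seven chunks to spare. [folklore] -/
theorem Good.κ_range (hV : P.Valid) (hD : D.Good P) (a : Fin 4) :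
    7 * (P.s : ℤ) ≤ D.κ P a ∧ D.κ P a + 7 * P.s ≤ 12 * P.M := by
  obtain ⟨h1, h2⟩ := hD.κ_mem hV a
  have hi : (D.i a : ℤ) ≤ 5 := by have := hD.hi a; omega
  have hM : (0 : ℤ) ≤ P.M := by positivity
  have hi0 : (0 : ℤ) ≤ D.i a := by positivity
  constructor <;> nlinarith

/-- Tip keys lie in `[0, 12M)`. [folklore] -/
theorem Good.κz_range (hV : P.Valid) (hD : D.Good P) (a : Fin 4) : 0 ≤ D.κz P a ∧ D.κz P a < 12 * P.M := by
  obtain ⟨-, -, -, -, -, -, -, -, -, za1, za2⟩ := hD.facts hV a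
  have b := frKey_mem_block (M := P.M) (hD.hi a) za1 za2
  have hi : (D.i a : ℤ) ≤ 5 := by have := hD.hi a; omega
  have hM : (0 : ℤ) ≤ P.M := by positivity
  have hi0 : (0 : ℤ) ≤ D.i a := by positivity
  unfold κz
  constructor <;> nlinarith [b.1, b.2]

/-- **Distinct spoke keys are six chunks apart.** [folklore] -/
theorem Good.κ_far (hV : P.Valid) (hD : D.Good P) {a b : Fin 4} (hab : a ≠ b) :
    D.κ P a + 6 * P.s ≤ D.κ P b ∨ D.κ P b + 6 * P.s ≤ D.κ P a := by
  have hs0 : (0 : ℤ) ≤ P.s := by positivity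
  by_cases hi : D.i a = D.i b
  · have hia := hD.hi a
    rcases lt_trichotomy (D.ζ a) (D.ζ b) with h | h | h
    · have g := hD.gap hV hab hi h
      have e : D.κ P b = D.κ P a + orient (D.i a) * (D.ξ P b - D.ξ P a) := by
        unfold κ; rw [← hi, ← frKey_add hia]; ring_nf
      rw [e]; unfold orient; split_ifs <;> [right; left] <;> nlinarith
    · exact absurd h (hD.zeta_ne hV hab hi)
    · have g := hD.gap hV (Ne.symm hab) hi.symm h
      have e : D.κ P a = D.κ P b + orient (D.i b) * (D.ξ P a - D.ξ P b) := by
        unfold κ; rw [hi, ← frKey_add (hD.hi b)]; ring_nf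
      rw [e]; unfold orient; split_ifs <;> [left; right] <;> nlinarith
  · obtain ⟨a1, a2⟩ := hD.κ_mem hV a
    obtain ⟨b1, b2⟩ := hD.κ_mem hV b
    have hM : (0 : ℤ) ≤ P.M := by positivity
    rcases Nat.lt_or_gt_of_ne hi with h | h
    · left; have : (D.i a : ℤ) + 1 ≤ D.i b := by exact_mod_cast h
      nlinarith
    · right; have : (D.i b : ℤ) + 1 ≤ D.i a := by exact_mod_cast h
      nlinarith

/-- **Target facts**: the target rows lie in the middle landing band, the target object's rows
`[t, t + (d-1) s]` cover the approach rows `[t, t + N'/64]`, and the target keys lie seven chunks inside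
their blocks. [folklore] -/
theorem tgt_facts (hV : P.Valid) (htc : ∀ e, tc e < 5) (e : Fin 4) :
    -(2 * (P.M : ℤ)) + (4 * P.M / 16 : ℕ) ≤ t P tc e ∧ t P tc e ≤ -(P.M : ℤ) - (4 * P.M / 16 : ℕ) ∧
      ((P.N' / 64 : ℕ) : ℤ) ≤ ((P.d - 1 : ℕ) : ℤ) * P.s ∧ ((P.d - 1 : ℕ) : ℤ) * P.s ≤ (P.N' / 64 : ℕ) + 2 * P.s ∧
      -(2 * (P.M : ℤ)) + 7 * P.s ≤ t P tc e ∧ t P tc e + ((P.d - 1 : ℕ) : ℤ) * P.s + 7 * P.s ≤ 0 ∧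
      2 * (P.M : ℤ) * (Slot4.ts e) + 7 * P.s ≤ γ P tc e ∧ γ P tc e + 7 * P.s ≤ 2 * (P.M : ℤ) * (Slot4.ts e + 1) ∧
      Slot4.ts e < 6 := by
  obtain ⟨hs, hk₀, hμ, -, -, -, -, -, -, -, -, -, -, -, -, hN, -, -, -, hμM, -⟩ := hV.ifacts
  obtain ⟨t1, t2⟩ := hV.tgtRow4_mem (htc e)
  have hts : Slot4.ts e < 6 := by unfold Slot4.ts Slot4.bs; split_ifs <;> omega
  have hd : P.d - 1 = P.N' / 64 / P.s + 2 := by unfold OParams.d; generalize P.N' / 64 / P.s = x; omega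
  have hk : 1 ≤ P.s := by have : P.s = P.k₀ := rfl; omega
  have hd1 : ((P.N' / 64 : ℕ) : ℤ) ≤ ((P.d - 1 : ℕ) : ℤ) * P.s := by
    rw [hd]; have := Nat.lt_div_mul_add (a := P.N' / 64) hk; push_cast at this ⊢; nlinarith
  have hd2 : ((P.d - 1 : ℕ) : ℤ) * P.s ≤ (P.N' / 64 : ℕ) + 2 * P.s := by
    rw [hd]; have := Nat.div_mul_le_self (P.N' / 64) P.s; push_cast at this ⊢; nlinarith
  have hN64 : ((P.N' / 64 : ℕ) : ℤ) ≤ P.M := by have : P.N' = 4 * P.M := rfl; omega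
  have h16 : ((4 * P.M / 16 : ℕ) : ℤ) ≥ 0 := by positivity
  have h16' : 4 * ((4 * P.M / 16 : ℕ) : ℤ) ≤ P.M := by omega
  have h16'' : (P.M : ℤ) ≤ 4 * ((4 * P.M / 16 : ℕ) : ℤ) + 4 := by omega
  have ht1 : -(2 * (P.M : ℤ)) + 7 * P.s ≤ t P tc e := by unfold t; linarith
  have ht2 : t P tc e + ((P.d - 1 : ℕ) : ℤ) * P.s + 7 * P.s ≤ 0 := by unfold t; nlinarith
  refine ⟨t1, t2, hd1, hd2, ht1, ht2, ?_, ?_, hts⟩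
  · exact (frKey_bounds hts ht1 (by nlinarith)).1
  · exact (frKey_bounds hts ht1 (by nlinarith)).2

/-- **A spoke key and a target key are six chunks apart** (targets off the danger zones). [folklore] -/
theorem Good.κγ_far (hV : P.Valid) (hD : D.Good P) (htc : ∀ e, tc e < 5) (htgt : D.TgtOK P tc) (a e : Fin 4) :
    D.κ P a + 6 * P.s ≤ γ P tc e ∨ γ P tc e + 6 * P.s ≤ D.κ P a := by
  have hs0 : (0 : ℤ) ≤ P.s := by positivity
  have hμ : 32 * (P.k₀ : ℤ) ≤ P.μ := hV.ifacts.2.2.1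
  have hsk : (P.s : ℤ) = P.k₀ := hV.ifacts.1
  obtain ⟨-, -, -, -, -, -, g1, g2, hts⟩ := tgt_facts hV htc e
  obtain ⟨a1, a2⟩ := hD.κ_mem hV a
  by_cases hi : D.i a = Slot4.ts e
  · have e1 : γ P tc e = D.κ P a + orient (D.i a) * (t P tc e - D.ξ P a) := by
      unfold γ κ; rw [← hi, ← frKey_add (hD.hi a)]; ring_nf
    rw [e1]
    rcases htgt.out e a hi with h | h <;> unfold orient <;> split_ifs
    · right; nlinarith
    · left; nlinarith
    · left; have : (0 : ℤ) ≤ ((P.N' / 64 : ℕ) : ℤ) := by positivity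
      nlinarith
    · right; have : (0 : ℤ) ≤ ((P.N' / 64 : ℕ) : ℤ) := by positivity
      nlinarith
  · have hM : (0 : ℤ) ≤ P.M := by positivity
    rcases Nat.lt_or_gt_of_ne hi with h | h
    · left; have : (D.i a : ℤ) + 1 ≤ Slot4.ts e := by exact_mod_cast h
      nlinarith
    · right; have : (Slot4.ts e : ℤ) + 1 ≤ D.i a := by exact_mod_cast h
      nlinarith

/-- **Target keys increase with the landing side**: `γ 0 < γ 1 < γ 2 < γ 3` (sides `0 < 2 < 3 < 5`). [folklore] -/
theorem γ_strictMono (hV : P.Valid) (htc : ∀ e, tc e < 5) : StrictMono (γ P tc) := by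
  have hM : (0 : ℤ) ≤ P.M := by positivity
  have hs0 : (0 : ℤ) ≤ P.s := by positivity
  have hs1 : (1 : ℤ) ≤ P.s := by have := hV.ifacts.1; have := hV.ifacts.2.1; linarith
  have key : ∀ e e' : Fin 4, Slot4.ts e < Slot4.ts e' → γ P tc e < γ P tc e' := by
    intro e e' h
    obtain ⟨-, -, -, -, -, -, g1, g2, -⟩ := tgt_facts hV htc e
    obtain ⟨-, -, -, -, -, -, g1', g2', -⟩ := tgt_facts hV htc e'
    have : (Slot4.ts e : ℤ) + 1 ≤ Slot4.ts e' := by exact_mod_cast h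
    have hmul := mul_le_mul_of_nonneg_left this hM
    linarith
  intro e e' h
  apply key
  have he := e.isLt; have he' := e'.isLt
  have h' : (e : ℕ) < e' := h
  unfold Slot4.ts Slot4.bs; split_ifs <;> omega

/-- **The targets can be chosen off the danger zones**: each of the at most four tips of the frame
`ts e` excludes at most one of the five candidate rows (their spacing `sp` exceeds the length
`N'/64 + 2μ + 16 s` of a danger zone). [folklore] -/
theorem exists_tgt (D : TipData) : ∃ tc : Fin 4 → ℕ, (∀ e, tc e < 5) ∧ D.TgtOK P tc := by
  classical
  have hsp : (P.sp : ℤ) = (P.N' / 64 : ℕ) + 2 * P.μ + 16 * P.s + 1 := by unfold OParams.sp; push_cast; ring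
  -- the candidates excluded for the side of `e`
  have hex : ∀ e : Fin 4, ∃ c, c < 5 ∧ ∀ a, D.i a = Slot4.ts e →
      D.ξ P a + P.μ + 8 * P.s < P.tgtRow4 c ∨ P.tgtRow4 c + (P.N' / 64 : ℕ) + P.μ + 8 * P.s < D.ξ P a := by
    intro e
    -- tip `a` excludes the candidate `c` iff `tgtRow4 c` lies in `[ξ a - N'/64 - μ - 8s, ξ a + μ + 8s]`
    let bad : Fin 4 → Finset ℕ := fun a => (Finset.range 5).filter fun c =>
      ¬ (D.ξ P a + P.μ + 8 * P.s < P.tgtRow4 c ∨ P.tgtRow4 c + (P.N' / 64 : ℕ) + P.μ + 8 * P.s < D.ξ P a)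
    have hbad : ∀ a, (bad a).card ≤ 1 := by
      intro a
      refine Finset.card_le_one.2 fun c hc c' hc' => ?_
      simp only [bad, Finset.mem_filter, Finset.mem_range, not_or, not_lt] at hc hc'
      have e1 : P.tgtRow4 c = otgtRow P.N' false + c * P.sp := rfl
      have e2 : P.tgtRow4 c' = otgtRow P.N' false + c' * P.sp := rfl
      by_contra hne
      rcases Nat.lt_or_gt_of_ne hne with h | h
      · have : (c : ℤ) + 1 ≤ c' := by exact_mod_cast h
        have hsp0 : (0 : ℤ) ≤ P.sp := by positivity
        nlinarith [hc.2.1, hc.2.2, hc'.2.1, hc'.2.2]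
      · have : (c' : ℤ) + 1 ≤ c := by exact_mod_cast h
        have hsp0 : (0 : ℤ) ≤ P.sp := by positivity
        nlinarith [hc.2.1, hc.2.2, hc'.2.1, hc'.2.2]
    have hU : (Finset.univ.biUnion bad).card < (Finset.range 5).card := by
      calc (Finset.univ.biUnion bad).card ≤ ∑ a, (bad a).card := Finset.card_biUnion_le
        _ ≤ ∑ _a : Fin 4, 1 := Finset.sum_le_sum fun a _ => hbad a
        _ < (Finset.range 5).card := by simp
    have hsub : ¬ Finset.range 5 ⊆ Finset.univ.biUnion bad := fun h =>
      absurd (Finset.card_le_card h) (not_le.2 hU)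
    rw [Finset.not_subset] at hsub
    obtain ⟨c, hc, hcU⟩ := hsub
    refine ⟨c, Finset.mem_range.1 hc, fun a ha => ?_⟩
    by_contra hno
    exact hcU (Finset.mem_biUnion.2 ⟨a, Finset.mem_univ _, Finset.mem_filter.2 ⟨hc, hno⟩⟩)
  choose tc htc htgt using hex
  exact ⟨tc, htc, ⟨fun e a ha => htgt e a ha⟩⟩

end TipData

/-! ### InArc algebra -/

/-- Reduction modulo `G` of a number below `2G`. [folklore] -/
theorem mod_two_cases {x G : ℕ} (hx : x < 2 * G) :
    ∃ r, x % G = r ∧ r < G ∧ (r = x ∨ r + G = x) := by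
  by_cases h : x < G
  · exact ⟨x, Nat.mod_eq_of_lt h, h, Or.inl rfl⟩
  · refine ⟨x - G, ?_, by omega, Or.inr (by omega)⟩
    rw [Nat.mod_eq_sub_mod (by omega), Nat.mod_eq_of_lt (by omega)]

/-- **Arcs are rotation invariant**: rotating the start and the position by the same amount. [folklore] -/
theorem inArc_rot {G A len sh p : ℕ} (hA : A < G) (hp : p < G) (hsh : sh ≤ G) :
    InArc G ((A + G - sh) % G) len ((p + G - sh) % G) ↔ InArc G A len p := by
  unfold InArc
  obtain ⟨a, ha, haG, ha'⟩ := mod_two_cases (show A + G - sh < 2 * G by omega)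
  obtain ⟨q, hq, hqG, hq'⟩ := mod_two_cases (show p + G - sh < 2 * G by omega)
  rw [ha, hq]
  obtain ⟨m, hm, hmG, hm'⟩ := mod_two_cases (show q + G - a < 2 * G by omega)
  obtain ⟨m', hm2, hmG', hm2'⟩ := mod_two_cases (show p + G - A < 2 * G by omega)
  rw [hm, hm2]
  constructor <;> intro h <;> omega

/-- **Membership in the hull arc**: the arc starting at the read position `hs` (absolute position
`(pc + hs) % G`) of length `he - hs + 1` consists of the positions reading in `[hs, he]`. [folklore] -/
theorem inArc_hull_iff {G pc hs he p : ℕ} (hpc : pc < G) (hp : p < G) (hhs : hs ≤ he) (hhe : he < G) :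
    InArc G ((pc + hs) % G) (he - hs + 1) p ↔ hs ≤ linPos G pc p ∧ linPos G pc p ≤ he := by
  unfold InArc linPos
  obtain ⟨a, ha, haG, ha'⟩ := mod_two_cases (show pc + hs < 2 * G by omega)
  obtain ⟨L, hL, hLG, hL'⟩ := mod_two_cases (show p + G - pc < 2 * G by omega)
  rw [ha, hL]
  obtain ⟨m, hm, hmG, hm'⟩ := mod_two_cases (show p + G - a < 2 * G by omega)
  rw [hm]
  constructor <;> intro h <;> omega

/-- **Half-turn of the ring**: the piece of lateral index `ι` of the side `(f + 3) % 6` is the piece of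
the side `f` rotated by half the ring. [folklore] -/
theorem piecePos_frame_add_three {n f ι : ℕ} (hn : 1 ≤ n) (hf : f < 6) (hι : ι < n) :
    piecePos n ((f + 3) % 6) ι = (piecePos n f ι + (12 * n - 4) - (6 * n - 2)) % (12 * n - 4) := by
  interval_cases f
  · show piecePos n 3 ι = (piecePos n 0 ι + (12 * n - 4) - (6 * n - 2)) % (12 * n - 4)
    rw [piecePos_eq_of_ne (by decide), piecePos_eq_of_ne (by decide)]; simp only [blockOff]
    rw [Nat.mod_eq_of_lt (by omega)]; omega
  · show piecePos n 4 ι = (piecePos n 1 ι + (12 * n - 4) - (6 * n - 2)) % (12 * n - 4)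
    rw [piecePos_eq_of_ne (by decide), piecePos_eq_of_ne (by decide)]; simp only [blockOff]
    rw [Nat.mod_eq_of_lt (by omega)]; omega
  · show piecePos n 5 ι = (piecePos n 2 ι + (12 * n - 4) - (6 * n - 2)) % (12 * n - 4)
    rw [piecePos_eq_of_two (by decide), piecePos_eq_of_two (by decide)]; simp only [blockOff]
    rw [Nat.mod_eq_of_lt (by omega)]; omega
  · show piecePos n 0 ι = (piecePos n 3 ι + (12 * n - 4) - (6 * n - 2)) % (12 * n - 4)
    rw [piecePos_eq_of_ne (by decide), piecePos_eq_of_ne (by decide)]; simp only [blockOff]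
    rw [show 6 * n - 2 + 2 * ι + (12 * n - 4) - (6 * n - 2) = 2 * ι + (12 * n - 4) by omega, Nat.add_mod_right,
      Nat.mod_eq_of_lt (by omega)]; omega
  · show piecePos n 1 ι = (piecePos n 4 ι + (12 * n - 4) - (6 * n - 2)) % (12 * n - 4)
    rw [piecePos_eq_of_ne (by decide), piecePos_eq_of_ne (by decide)]; simp only [blockOff]
    rw [show 8 * n - 3 + 2 * ι + (12 * n - 4) - (6 * n - 2) = 2 * n - 1 + 2 * ι + (12 * n - 4) by omega, Nat.add_mod_right,
      Nat.mod_eq_of_lt (by omega)]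
  · show piecePos n 2 ι = (piecePos n 5 ι + (12 * n - 4) - (6 * n - 2)) % (12 * n - 4)
    rw [piecePos_eq_of_two (by decide), piecePos_eq_of_two (by decide)]; simp only [blockOff]
    rw [show 10 * n - 3 + 2 * (n - 1 - ι) + (12 * n - 4) - (6 * n - 2) = 4 * n - 1 + 2 * (n - 1 - ι) + (12 * n - 4) by omega,
      Nat.add_mod_right, Nat.mod_eq_of_lt (by omega)]

/-- **The base side and the landing side**: the piece of the landing side `ts e` is the piece of the
base side `bs e`, shifted by half the ring for the arms `e = 2, 3`. [folklore] -/
theorem piecePos_ts (e : Fin 4) {n ι : ℕ} (hn : 1 ≤ n) (hι : ι < n) :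
    piecePos n (Slot4.ts e) ι = piecePos n (Slot4.bs e) ι + (if 2 ≤ (e : ℕ) then 6 * n - 2 else 0) := by
  have he := e.isLt
  have hts : Slot4.ts e = (if 2 ≤ (e : ℕ) then Slot4.bs e + 3 else Slot4.bs e) := rfl
  have hbs : Slot4.bs e = (if (e : ℕ) % 2 = 0 then 0 else 2) := rfl
  by_cases h2 : 2 ≤ (e : ℕ)
  · rw [hts, if_pos h2, if_pos h2, hbs]
    by_cases h0 : (e : ℕ) % 2 = 0
    · rw [if_pos h0]
      show piecePos n 3 ι = piecePos n 0 ι + (6 * n - 2)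
      rw [piecePos_eq_of_ne (by decide), piecePos_eq_of_ne (by decide)]; simp only [blockOff]; omega
    · rw [if_neg h0]
      show piecePos n 5 ι = piecePos n 2 ι + (6 * n - 2)
      rw [piecePos_eq_of_two (by decide), piecePos_eq_of_two (by decide)]; simp only [blockOff]; omega
  · rw [hts, if_neg h2, if_neg h2]; rfl

namespace TipData

/-! ### The routing certificate -/

/-- **A routing certificate**: the cut key `c`, the rotations `jt` (first tip after the cut is the tip
`jt + 1`) and `kt` (first target after the cut is the side `kt`), and whether the cut lies after
(`up`) or before the spoke key of the closed tip `1`. [folklore] -/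
structure Route where
  /-- the cut key -/
  c : ℤ
  /-- tip rotation -/
  jt : Fin 4
  /-- target rotation -/
  kt : Fin 4
  /-- the cut is after the key of the tip `1` -/
  up : Bool

variable (P : OParams) (D : TipData) (tc : Fin 4 → ℕ) (R : Route)

/-- reading index of the landing side `e` [folklore] -/
def Route.q (e : Fin 4) : Fin 4 := e - R.kt
/-- the tip routed to the landing side `e` [folklore] -/
def Route.tip (e : Fin 4) : Fin 4 := R.jt + R.q e + 1
/-- the tips, read from the cut [folklore] -/
def Tq (q : Fin 4) : ℤ := cyc (12 * P.M) R.c (D.κ P (R.jt + q + 1))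
/-- the targets, read from the cut [folklore] -/
def Gq (q : Fin 4) : ℤ := cyc (12 * P.M) R.c (γ P tc (R.kt + q))
/-- the level of the ring road of the landing side `e` [folklore] -/
def lv (e : Fin 4) : ℕ := laneLevel (Tq P D R) (Gq P tc R) (R.q e)
/-- the cut row (on the frame of the tip `1`) [folklore] -/
def ρC : ℤ := if R.up then D.ξ P 1 + orient (D.i 1) * (3 * P.s) else D.ξ P 1 - orient (D.i 1) * (3 * P.s)
/-- the cut object [folklore] -/
def C : RingObj := ⟨D.i 1, ρC P D R, ρC P D R⟩
/-- the tip object of the tip `a` (its spoke row) [folklore] -/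
def X (a : Fin 4) : RingObj := ⟨D.i a, D.ξ P a, D.ξ P a⟩
/-- the target object of the landing side `e` (approach rows and exit run) [folklore] -/
def Y (e : Fin 4) : RingObj := ⟨Slot4.ts e, t P tc e, t P tc e + ((P.d - 1 : ℕ) : ℤ) * P.s⟩
/-- chunks per side of the ring of `e` [folklore] -/
def nE (e : Fin 4) : ℕ := P.nL (lv P D tc R e)
/-- radius of the ring of `e` [folklore] -/
def rE (e : Fin 4) : ℕ := P.rL (lv P D tc R e)
/-- tubes of the ring of `e` [folklore] -/
def GE (e : Fin 4) : ℕ := P.Gr (lv P D tc R e)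
/-- the cut position on the ring of `e` [folklore] -/
def pc (e : Fin 4) : ℕ := (C P D R).cutPos (nE P D tc R e) P.s (rE P D tc R e)
/-- read position on the ring of `e` [folklore] -/
def lp (e : Fin 4) (p : ℕ) : ℕ := linPos (GE P D tc R e) (pc P D tc R e) p
/-- start of the hull of `e` (read position) [folklore] -/
def hs (e : Fin 4) : ℕ :=
  min (lp P D tc R e ((X P D (R.tip e)).wlo (nE P D tc R e) P.s (rE P D tc R e)))
    (lp P D tc R e ((Y P tc e).wlo (nE P D tc R e) P.s (rE P D tc R e)))
/-- end of the hull of `e` (read position) [folklore] -/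
def he (e : Fin 4) : ℕ :=
  max (lp P D tc R e ((X P D (R.tip e)).whi (nE P D tc R e) P.s (rE P D tc R e)))
    (lp P D tc R e ((Y P tc e).whi (nE P D tc R e) P.s (rE P D tc R e)))
/-- start of the arc of `e` (absolute position) [folklore] -/
def astAbs (e : Fin 4) : ℕ := (pc P D tc R e + hs P D tc R e) % GE P D tc R e
/-- length of the arc of `e` [folklore] -/
def alnE (e : Fin 4) : ℕ := he P D tc R e - hs P D tc R e + 1
/-- the half-turn of the reading configuration of `e` [folklore] -/
def shE (e : Fin 4) : ℕ := if 2 ≤ (e : ℕ) then 6 * nE P D tc R e - 2 else 0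
/-- start of the arc of `e` (reading position) [folklore] -/
def astE (e : Fin 4) : ℕ := (astAbs P D tc R e + GE P D tc R e - shE P D tc R e) % GE P D tc R e
/-- the rows of the routed slot [folklore] -/
def slotF : Fin 7 → Fin 4 → ℕ :=
  ![fun e => D.i (R.tip e), fun e => D.j (R.tip e), fun e => D.ν (R.tip e), tc, lv P D tc R, astE P D tc R, alnE P D tc R]
/-- **The routed slot.** [folklore] -/
def slot : Slot4 := ⟨slotF P D tc R⟩

/-- **A good routing certificate** (what `Lanes.exists_cut'` provides): the cut key is `κ 1 ± 3s`, the
tips and the targets read increasingly from the cut, all at least three chunks from it, and the parities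
of the two rotations are complementary (the first tip after the cut and the first target have the same
colour). [folklore] -/
structure Route.Good : Prop where
  /-- the cut key -/
  hc : R.c = (if R.up then D.κ P 1 + 3 * P.s else D.κ P 1 - 3 * P.s)
  /-- range of the cut key -/
  hc_range : 0 ≤ R.c ∧ R.c < 12 * P.M
  /-- the tips read increasingly -/
  hτ : Tq P D R 0 < Tq P D R 1 ∧ Tq P D R 1 < Tq P D R 2 ∧ Tq P D R 2 < Tq P D R 3
  /-- the targets read increasingly -/
  hγ : Gq P tc R 0 < Gq P tc R 1 ∧ Gq P tc R 1 < Gq P tc R 2 ∧ Gq P tc R 2 < Gq P tc R 3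
  /-- tips off the cut -/
  hfarτ : ∀ a, 3 * (P.s : ℤ) ≤ cyc (12 * P.M) R.c (D.κ P a)
  /-- targets off the cut -/
  hfarγ : ∀ e, 3 * (P.s : ℤ) ≤ cyc (12 * P.M) R.c (γ P tc e)
  /-- parities -/
  hpar : ((R.jt : ℕ) % 2 = 1 ↔ (R.kt : ℕ) % 2 = 0)

variable {P D tc R}

/-- Strict monotonicity on `Fin 4` from the three consecutive inequalities. [folklore] -/
theorem strictMono_four {f : Fin 4 → ℤ} (h0 : f 0 < f 1) (h1 : f 1 < f 2) (h2 : f 2 < f 3) : StrictMono f :=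
  Fin.strictMono_iff_lt_succ.2 fun i => by fin_cases i <;> assumption

/-- **The routing certificate exists** (order certificate of the tips from a base point `b₀`, targets
off the danger zones). [cite: Nolin2008, §4.3 Prop. 12 (i), §4.4 p. 12 (arXiv 0711.4948: Prop. 11; relocation of landing areas)] -/
theorem exists_route (hV : P.Valid) (hD : D.Good P) (htc : ∀ e, tc e < 5) (htgt : D.TgtOK P tc)
    (hchain : ∃ b₀ : ℤ, 0 ≤ b₀ ∧ b₀ < 12 * P.M ∧ cyc (12 * P.M) b₀ (D.κz P 1) < cyc (12 * P.M) b₀ (D.κz P 2) ∧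
      cyc (12 * P.M) b₀ (D.κz P 2) < cyc (12 * P.M) b₀ (D.κz P 3) ∧ cyc (12 * P.M) b₀ (D.κz P 3) < cyc (12 * P.M) b₀ (D.κz P 0)) :
    ∃ R : Route, R.Good P D tc := by
  obtain ⟨b₀, hb0, hb1, c1, c2, c3⟩ := hchain
  have hs1 : (1 : ℤ) ≤ P.s := by have := hV.ifacts.1; have := hV.ifacts.2.1; linarith
  set Pm : ℤ := 12 * P.M with hPm
  have zr := fun a => hD.κz_range hV a
  have kr : ∀ a, 0 ≤ D.κ P a ∧ D.κ P a < Pm := fun a => by have := hD.κ_range hV a; constructor <;> linarith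
  have gr : ∀ e, 0 ≤ γ P tc e ∧ γ P tc e < Pm := fun e => by
    obtain ⟨-, -, -, -, -, -, g1, g2, hts⟩ := tgt_facts hV htc e
    have hM : (0 : ℤ) ≤ P.M := by positivity
    have h6 : (Slot4.ts e : ℤ) ≤ 5 := by omega
    have h0 : (0 : ℤ) ≤ Slot4.ts e := by positivity
    constructor <;> nlinarith
  -- rebase the certificate at the tip `1`, then pass to the spoke keys
  have cyc_of_le : ∀ {y x : ℤ}, y ≤ x → cyc Pm y x = x - y := fun h => if_pos h
  have r2 : cyc Pm (D.κz P 1) (D.κz P 2) = cyc Pm b₀ (D.κz P 2) - cyc Pm b₀ (D.κz P 1) := by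
    rw [cyc_rebase ⟨hb0, hb1⟩ (zr 1) (zr 2), cyc_of_le c1.le]
  have r3 : cyc Pm (D.κz P 1) (D.κz P 3) = cyc Pm b₀ (D.κz P 3) - cyc Pm b₀ (D.κz P 1) := by
    rw [cyc_rebase ⟨hb0, hb1⟩ (zr 1) (zr 3), cyc_of_le (c1.trans c2).le]
  have r0 : cyc Pm (D.κz P 1) (D.κz P 0) = cyc Pm b₀ (D.κz P 0) - cyc Pm b₀ (D.κz P 1) := by
    rw [cyc_rebase ⟨hb0, hb1⟩ (zr 1) (zr 0), cyc_of_le ((c1.trans c2).trans c3).le]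
  have z12 : cyc Pm (D.κz P 1) (D.κz P 2) < cyc Pm (D.κz P 1) (D.κz P 3) := by rw [r2, r3]; linarith
  have z23 : cyc Pm (D.κz P 1) (D.κz P 3) < cyc Pm (D.κz P 1) (D.κz P 0) := by rw [r3, r0]; linarith
  have iso := fun {a b : Fin 4} (h : a ≠ b) => hD.κz_lt_iff hV h
  have t12 : cyc Pm (D.κ P 1) (D.κ P 2) < cyc Pm (D.κ P 1) (D.κ P 3) :=
    (cyc_lt_cyc_iff_of_iso (zr 2) (zr 3) (kr 2) (kr 3) (iso (by decide)) (iso (by decide)) (iso (by decide))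
      (iso (by decide)) (iso (by decide))).1 z12
  have t23 : cyc Pm (D.κ P 1) (D.κ P 3) < cyc Pm (D.κ P 1) (D.κ P 0) :=
    (cyc_lt_cyc_iff_of_iso (zr 3) (zr 0) (kr 3) (kr 0) (iso (by decide)) (iso (by decide)) (iso (by decide))
      (iso (by decide)) (iso (by decide))).1 z23
  -- separations
  have far := fun {x y : ℤ} (hx : 0 ≤ x) (hy : 0 ≤ y) (hxP : x + 6 * P.s ≤ Pm) (hyP : y + 6 * P.s ≤ Pm)
    (hxy : x + 6 * P.s ≤ y ∨ y + 6 * P.s ≤ x) => cyc_far (P := Pm) hx hy hxP hyP hxy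
  have kP : ∀ a, D.κ P a + 6 * P.s ≤ Pm := fun a => by have := (hD.κ_range hV a).2; linarith
  have gP : ∀ e, γ P tc e + 6 * P.s ≤ Pm := fun e => by
    obtain ⟨-, -, -, -, -, -, -, g2, hts⟩ := tgt_facts hV htc e
    have hM : (0 : ℤ) ≤ P.M := by positivity
    have h6 : (Slot4.ts e : ℤ) ≤ 5 := by omega
    nlinarith
  have sepτ1 := far (kr 1).1 (kr 2).1 (kP 1) (kP 2) (hD.κ_far hV (by decide))
  have sepτ3 := far (kr 1).1 (kr 0).1 (kP 1) (kP 0) (hD.κ_far hV (by decide))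
  have sepγ : ∀ e, 2 * (3 * (P.s : ℤ)) ≤ cyc Pm (D.κ P 1) (γ P tc e) ∧ cyc Pm (D.κ P 1) (γ P tc e) ≤ Pm - 2 * (3 * P.s) := by
    intro e
    have := far (kr 1).1 (gr e).1 (kP 1) (gP e) (hD.κγ_far hV htc htgt 1 e)
    constructor <;> linarith [this.1, this.2]
  -- targets: increasing keys
  have gmono := γ_strictMono (P := P) (tc := tc) hV htc
  have g01 : γ P tc 0 < γ P tc 1 := gmono (by decide)
  have g12 : γ P tc 1 < γ P tc 2 := gmono (by decide)
  have g23 : γ P tc 2 < γ P tc 3 := gmono (by decide)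
  have hγcyc : cyc Pm (γ P tc 0) (γ P tc 1) < cyc Pm (γ P tc 0) (γ P tc 2) ∧
      cyc Pm (γ P tc 0) (γ P tc 2) < cyc Pm (γ P tc 0) (γ P tc 3) := by
    unfold cyc; rw [if_pos g01.le, if_pos (g01.trans g12).le, if_pos ((g01.trans g12).trans g23).le]
    constructor <;> linarith
  have hγ1 : 0 < cyc Pm (γ P tc 0) (γ P tc 1) := by unfold cyc; rw [if_pos g01.le]; linarith
  -- the cut
  obtain ⟨c, hc0, hc1, hcform, jt, kt, hτo, hγo, hfτ, hfγ, hpar⟩ :=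
    exists_cut' (P := Pm) (h := 3 * P.s) (by linarith) (τ := fun j => D.κ P (j + 1)) (γ := γ P tc) false
      (fun j => kr (j + 1)) gr (by exact ⟨t12, t23⟩) hγcyc hγ1
      (by show 2 * (3 * (P.s : ℤ)) ≤ cyc Pm (D.κ P 1) (D.κ P 2) ∧ cyc Pm (D.κ P 1) (D.κ P 0) ≤ Pm - 2 * (3 * P.s)
          exact ⟨by linarith [sepτ1.1], by linarith [sepτ3.2]⟩) sepγ
  -- which side of `κ 1` the cut is
  have hk1 := hD.κ_range hV 1
  have hform : ∃ up : Bool, c = (if up then D.κ P 1 + 3 * P.s else D.κ P 1 - 3 * P.s) := by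
    rcases hcform with h | h
    · refine ⟨false, ?_⟩
      rw [h]; simp only [show ((0 : Fin 4) + 1 : Fin 4) = 1 from rfl]
      rw [if_pos (by linarith)]; simp
    · refine ⟨true, ?_⟩
      rw [h]; simp only [show ((0 : Fin 4) + 1 : Fin 4) = 1 from rfl]
      rw [if_pos (by linarith)]; simp
  obtain ⟨up, hup⟩ := hform
  refine ⟨⟨c, jt, kt, up⟩, hup, ⟨hc0, hc1⟩, ?_, ?_, fun a => ?_, fun e => (hfγ e).1, ?_⟩
  · simp only [Tq]
    simp only [show jt + 0 + 1 = jt + 1 from by rw [add_zero]] 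
    exact hτo
  · simp only [Gq]
    simp only [show kt + 0 = kt from add_zero kt]
    exact hγo
  · have := (hfτ (a - 1)).1
    simp only [sub_add_cancel] at this
    exact this
  · have h := hpar
    simp only [Bool.false_xor] at h
    constructor
    · intro hj
      have : decide ((jt : ℕ) % 2 = 1) = true := by simpa using hj
      rw [this] at h; simpa using h.symm
    · intro hk
      have : decide ((kt : ℕ) % 2 = 0) = true := by simpa using hk
      rw [this] at h; simpa using h

/-! ### Reading the certificate -/

namespace Route

/-- The value of the reading index. [folklore] -/
theorem q_val (R : Route) (e : Fin 4) : ((R.q e : Fin 4) : ℕ) = (4 - (R.kt : ℕ) + e) % 4 := rfl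

/-- The value of the routed tip. [folklore] -/
theorem tip_val (R : Route) (e : Fin 4) : ((R.tip e : Fin 4) : ℕ) = (((R.jt : ℕ) + (4 - (R.kt : ℕ) + e) % 4) % 4 + 1) % 4 := rfl

/-- Distinct landing sides read at distinct indices. [folklore] -/
theorem q_ne (R : Route) {e b : Fin 4} (h : e ≠ b) : R.q e ≠ R.q b := fun h' => h (sub_left_injective h')

/-- Distinct landing sides get distinct tips. [folklore] -/
theorem tip_ne (R : Route) {e b : Fin 4} (h : e ≠ b) : R.tip e ≠ R.tip b := fun h' =>
  R.q_ne h (add_left_cancel (add_right_cancel h'))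

/-- **The routed tip has the colour of its landing side** (good certificate). [folklore] -/
theorem Good.tip_parity (hR : R.Good P D tc) (e : Fin 4) : ((R.tip e : Fin 4) : ℕ) % 2 = (e : ℕ) % 2 := by
  have h := hR.hpar
  rw [tip_val]
  have hj := R.jt.isLt; have hk := R.kt.isLt; have he := e.isLt
  omega

/-- Arms of different colours are routed from tips of different colours. [folklore] -/
theorem Good.tip_parity_ne (hR : R.Good P D tc) {e b : Fin 4} (h : Slot4.col e ≠ Slot4.col b) :
    ((R.tip e : Fin 4) : ℕ) % 2 ≠ ((R.tip b : Fin 4) : ℕ) % 2 := by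
  rw [hR.tip_parity, hR.tip_parity]
  intro h'
  apply h
  unfold Slot4.col
  rw [h']

end Route

/-- The targets read at the reading index of their side. [folklore] -/
theorem Gq_q (e : Fin 4) : Gq P tc R (R.q e) = cyc (12 * P.M) R.c (γ P tc e) := by
  unfold Gq Route.q; rw [add_sub_cancel]

/-- The key of the cut row is the cut key. [folklore] -/
theorem key_C (hD : D.Good P) (hR : R.Good P D tc) : frKey P.M (D.i 1) (ρC P D R) = R.c := by
  have ho := orient_mul_orient (D.i 1)
  rw [hR.hc]; unfold ρC κ
  cases hu : R.up
  · simp only [Bool.false_eq_true, if_false]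
    rw [sub_eq_add_neg, frKey_add (hD.hi 1)]
    linear_combination (-(3 * (P.s : ℤ))) * ho
  · simp only [if_true]
    rw [frKey_add (hD.hi 1)]
    linear_combination (3 * (P.s : ℤ)) * ho

/-- The cut row is three chunks above or below the spoke row of the tip `1`. [folklore] -/
theorem ρC_cases (R : Route) : ρC P D R = D.ξ P 1 + 3 * P.s ∨ ρC P D R = D.ξ P 1 - 3 * P.s := by
  unfold ρC orient
  split_ifs <;> first | (left; ring1) | (right; ring1)

/-- **The ring of the landing side `e`.** [folklore] -/
theorem ringE_facts (hV : P.Valid) (e : Fin 4) :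
    1 ≤ nE P D tc R e ∧ ((nE P D tc R e : ℕ) : ℤ) * P.s = rE P D tc R e ∧ 2 * P.M ≤ rE P D tc R e ∧
      GE P D tc R e = 12 * nE P D tc R e - 4 ∧ nE P D tc R e ≤ P.nL 7 ∧ lv P D tc R e < 8 := by
  have hlv : lv P D tc R e < 8 := laneLevel_lt _ _ _
  obtain ⟨h1, -, h3, h4, -, -, h7, -⟩ := hV.ring_facts hlv
  obtain ⟨-, g2, g3, -, -, -, -, -⟩ := hV.ring_facts (show 7 < 8 by norm_num)
  obtain ⟨hs, -, -, -, hk₀, -⟩ := hV.facts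
  have hle : P.rL (lv P D tc R e) ≤ P.rL 7 := by
    unfold OParams.rL
    have : (2 * P.M + (2 * lv P D tc R e + 1) * P.μ) / P.s ≤ (2 * P.M + (2 * 7 + 1) * P.μ) / P.s :=
      Nat.div_le_div_right (by nlinarith)
    nlinarith
  have hn7 : P.nL (lv P D tc R e) ≤ P.nL 7 := by
    by_contra h; push Not at h
    have : (P.nL 7 + 1) * P.s ≤ P.nL (lv P D tc R e) * P.s := Nat.mul_le_mul_right _ h
    rw [add_mul, one_mul, g3, h3] at this; omega
  exact ⟨h4, by exact_mod_cast h3, by unfold rE; omega, h7, hn7, hlv⟩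

/-- The cut object is in range on every ring. [folklore] -/
theorem C_ok (hV : P.Valid) (hD : D.Good P) (e : Fin 4) : (C P D R).OK P.s (rE P D tc R e) P.M := by
  obtain ⟨-, -, -, -, -, -, -, x1, x2, -⟩ := hD.facts hV 1
  obtain ⟨-, -, hMr, -⟩ := ringE_facts (D := D) (tc := tc) (R := R) hV e
  have hs0 : (0 : ℤ) ≤ P.s := by positivity
  rcases ρC_cases (P := P) (D := D) R with h | h <;>
    exact ⟨hD.hi 1, le_rfl, by show _ ≤ ρC P D R; rw [h]; linarith, by show ρC P D R + _ < 0; rw [h]; linarith, hMr⟩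

/-- The tip objects are in range on every ring. [folklore] -/
theorem X_ok (hV : P.Valid) (hD : D.Good P) (a e : Fin 4) : (X P D a).OK P.s (rE P D tc R e) P.M := by
  obtain ⟨-, -, -, -, -, -, -, x1, x2, -⟩ := hD.facts hV a
  obtain ⟨-, -, hMr, -⟩ := ringE_facts (D := D) (tc := tc) (R := R) hV e
  have hs0 : (0 : ℤ) ≤ P.s := by positivity
  exact ⟨hD.hi a, le_rfl, by show _ ≤ D.ξ P a; linarith, by show D.ξ P a + _ < 0; linarith, hMr⟩

/-- The target objects are in range on every ring. [folklore] -/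
theorem Y_ok (hV : P.Valid) (htc : ∀ e, tc e < 5) (e' e : Fin 4) : (Y P tc e').OK P.s (rE P D tc R e) P.M := by
  obtain ⟨-, -, -, -, t1, t2, -, -, hts⟩ := tgt_facts hV htc e'
  obtain ⟨-, -, hMr, -⟩ := ringE_facts (D := D) (tc := tc) (R := R) hV e
  have hs1 : (1 : ℤ) ≤ P.s := by have := hV.ifacts.1; have := hV.ifacts.2.1; linarith
  have hd0 : (0 : ℤ) ≤ ((P.d - 1 : ℕ) : ℤ) * P.s := by positivity
  exact ⟨hts, by show t P tc e' ≤ t P tc e' + _; linarith, by show _ ≤ t P tc e'; linarith,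
    by show t P tc e' + _ + _ < 0; linarith, hMr⟩

/-- **Comparability from the rows**: objects on different frames, or on a common frame with rows `g`
chunks apart, are comparable in the frame-lexicographic order. [folklore] -/
theorem before_or {g s : ℕ} {X C : RingObj} (h : X.fr ≠ C.fr ∨ X.hi + g * s ≤ C.lo ∨ C.hi + g * s ≤ X.lo) :
    RingObj.Before g s X C ∨ RingObj.Before g s C X := by
  unfold RingObj.Before
  rcases lt_trichotomy X.fr C.fr with hlt | heq | hgt
  · exact Or.inl (Or.inl hlt)
  · rcases h with h | h | h
    · exact absurd heq h
    · by_cases h2 : X.fr % 3 = 2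
      · exact Or.inr (Or.inr ⟨heq.symm, fun h' => (h' (heq ▸ h2)).elim, fun _ => h⟩)
      · exact Or.inl (Or.inr ⟨heq, fun _ => h, fun h2' => (h2 h2').elim⟩)
    · by_cases h2 : X.fr % 3 = 2
      · exact Or.inl (Or.inr ⟨heq, fun h2' => (h2' h2).elim, fun _ => h⟩)
      · exact Or.inr (Or.inr ⟨heq.symm, fun _ => h, fun h2' => (h2 (heq.symm ▸ h2')).elim⟩)
  · exact Or.inr (Or.inl hgt)

/-- The tip objects are comparable with the cut (two chunks). [folklore] -/
theorem X_cut (hV : P.Valid) (hD : D.Good P) (a : Fin 4) :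
    RingObj.Before 2 P.s (X P D a) (C P D R) ∨ RingObj.Before 2 P.s (C P D R) (X P D a) := by
  apply before_or
  show D.i a ≠ D.i 1 ∨ D.ξ P a + 2 * P.s ≤ ρC P D R ∨ ρC P D R + 2 * P.s ≤ D.ξ P a
  by_cases hi : D.i a = D.i 1
  · right
    have hs0 : (0 : ℤ) ≤ P.s := by positivity
    rcases ρC_cases (P := P) (D := D) R with h | h <;> rw [h]
    · by_cases ha : a = 1
      · subst ha; left; linarith
      · rcases lt_trichotomy (D.ζ a) (D.ζ 1) with hl | hl | hl
        · have := hD.gap hV ha hi hl; left; linarith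
        · exact absurd hl (hD.zeta_ne hV ha hi)
        · have := hD.gap hV (Ne.symm ha) hi.symm hl; right; linarith
    · by_cases ha : a = 1
      · subst ha; right; linarith
      · rcases lt_trichotomy (D.ζ a) (D.ζ 1) with hl | hl | hl
        · have := hD.gap hV ha hi hl; left; linarith
        · exact absurd hl (hD.zeta_ne hV ha hi)
        · have := hD.gap hV (Ne.symm ha) hi.symm hl; right; linarith
  · exact Or.inl hi

/-- The target objects are comparable with the cut (two chunks). [folklore] -/
theorem Y_cut (hV : P.Valid) (htc : ∀ e, tc e < 5) (htgt : D.TgtOK P tc) (e' : Fin 4) :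
    RingObj.Before 2 P.s (Y P tc e') (C P D R) ∨ RingObj.Before 2 P.s (C P D R) (Y P tc e') := by
  apply before_or
  show Slot4.ts e' ≠ D.i 1 ∨ t P tc e' + ((P.d - 1 : ℕ) : ℤ) * P.s + 2 * P.s ≤ ρC P D R ∨ ρC P D R + 2 * P.s ≤ t P tc e'
  by_cases hi : D.i 1 = Slot4.ts e'
  · right
    have hs0 : (0 : ℤ) ≤ P.s := by positivity
    have hμ : 32 * (P.k₀ : ℤ) ≤ P.μ := hV.ifacts.2.2.1
    have hsk : (P.s : ℤ) = P.k₀ := hV.ifacts.1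
    obtain ⟨-, -, -, hd2, -⟩ := tgt_facts hV htc e'
    rcases ρC_cases (P := P) (D := D) R with h | h <;> rw [h] <;> rcases htgt.out e' 1 hi with h' | h'
    · right; linarith
    · left; linarith
    · right; linarith
    · left; linarith
  · exact Or.inl (Ne.symm hi)

/-- Distinct tip objects are separated. [folklore] -/
theorem sep_XX (hV : P.Valid) (hD : D.Good P) {a b : Fin 4} (hab : a ≠ b) : RingObj.Sep P.s (X P D a) (X P D b) := by
  intro hi
  show D.ξ P a + 3 * P.s ≤ D.ξ P b ∨ D.ξ P b + 3 * P.s ≤ D.ξ P a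
  have hs0 : (0 : ℤ) ≤ P.s := by positivity
  rcases lt_trichotomy (D.ζ a) (D.ζ b) with hl | hl | hl
  · have := hD.gap hV hab hi hl; left; linarith
  · exact absurd hl (hD.zeta_ne hV hab hi)
  · have := hD.gap hV (Ne.symm hab) (Eq.symm hi) hl; right; linarith

/-- A tip object and a target object are separated. [folklore] -/
theorem sep_XY (hV : P.Valid) (htc : ∀ e, tc e < 5) (htgt : D.TgtOK P tc) (a e' : Fin 4) :
    RingObj.Sep P.s (X P D a) (Y P tc e') := by
  intro hi
  show D.ξ P a + 3 * P.s ≤ t P tc e' ∨ t P tc e' + ((P.d - 1 : ℕ) : ℤ) * P.s + 3 * P.s ≤ D.ξ P a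
  have hs0 : (0 : ℤ) ≤ P.s := by positivity
  have hμ : 32 * (P.k₀ : ℤ) ≤ P.μ := hV.ifacts.2.2.1
  have hsk : (P.s : ℤ) = P.k₀ := hV.ifacts.1
  obtain ⟨-, -, -, hd2, -⟩ := tgt_facts hV htc e'
  rcases htgt.out e' a hi with h | h
  · left; linarith
  · right; linarith

/-- Separation is symmetric. [folklore] -/
theorem sep_symm {s : ℕ} {X Y : RingObj} (h : RingObj.Sep s X Y) : RingObj.Sep s Y X := fun hf => (h hf.symm).symm

/-- The landing sides are distinct frames. [folklore] -/
theorem ts_ne {e e' : Fin 4} (h : e ≠ e') : Slot4.ts e ≠ Slot4.ts e' := by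
  intro h'
  apply h
  have he := e.isLt; have he' := e'.isLt
  apply Fin.ext
  unfold Slot4.ts Slot4.bs at h'
  split_ifs at h' <;> omega

/-- Distinct target objects are separated (they are on distinct frames). [folklore] -/
theorem sep_YY {e e' : Fin 4} (h : e ≠ e') : RingObj.Sep P.s (Y P tc e) (Y P tc e') := fun hf => absurd hf (ts_ne h)

/-- **No tip reads like a target** from the cut. [folklore] -/
theorem Tq_ne_Gq (hV : P.Valid) (hD : D.Good P) (htc : ∀ e, tc e < 5) (htgt : D.TgtOK P tc)
    (q q' : Fin 4) : Tq P D R q ≠ Gq P tc R q' := by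
  intro h
  unfold Tq Gq at h
  have hs1 : (1 : ℤ) ≤ P.s := by have := hV.ifacts.1; have := hV.ifacts.2.1; linarith
  have kr : 0 ≤ D.κ P (R.jt + q + 1) ∧ D.κ P (R.jt + q + 1) < 12 * P.M := by
    have := hD.κ_range hV (R.jt + q + 1); constructor <;> linarith
  have gr : 0 ≤ γ P tc (R.kt + q') ∧ γ P tc (R.kt + q') < 12 * P.M := by
    obtain ⟨-, -, -, -, -, -, g1, g2, hts⟩ := tgt_facts hV htc (R.kt + q')
    have hM : (0 : ℤ) ≤ P.M := by positivity
    have h6 : (Slot4.ts (R.kt + q') : ℤ) ≤ 5 := by omega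
    have h0 : (0 : ℤ) ≤ Slot4.ts (R.kt + q') := by positivity
    constructor <;> nlinarith
  have heq := eq_of_cyc_eq kr gr h
  rcases hD.κγ_far hV htc htgt (R.jt + q + 1) (R.kt + q') with h' | h' <;> linarith

/-- **The hull facts of the landing side `e`**: the cut position and the hull ends are positions of the
ring, and the hull contains the read windows of the arm's own tip and target. [folklore] -/
theorem hull_facts (hV : P.Valid) (hD : D.Good P) (e : Fin 4) :
    pc P D tc R e < GE P D tc R e ∧ hs P D tc R e ≤ he P D tc R e ∧ he P D tc R e < GE P D tc R e ∧
      hs P D tc R e ≤ lp P D tc R e ((X P D (R.tip e)).wlo (nE P D tc R e) P.s (rE P D tc R e)) ∧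
      lp P D tc R e ((X P D (R.tip e)).whi (nE P D tc R e) P.s (rE P D tc R e)) ≤ he P D tc R e ∧
      hs P D tc R e ≤ lp P D tc R e ((Y P tc e).wlo (nE P D tc R e) P.s (rE P D tc R e)) ∧
      lp P D tc R e ((Y P tc e).whi (nE P D tc R e) P.s (rE P D tc R e)) ≤ he P D tc R e := by
  obtain ⟨hn1, hns, -, hG, -⟩ := ringE_facts (D := D) (tc := tc) (R := R) hV e
  have hs1 : 1 ≤ P.s := by have := hV.facts.1; have := hV.facts.2.2.2.2.1; omega
  have hC := C_ok (tc := tc) (R := R) hV hD e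
  have hXe := X_ok (tc := tc) (R := R) hV hD (R.tip e) e
  obtain ⟨-, -, bc, ec⟩ := RingObj.window_mem_block (n := nE P D tc R e) hC hs1 hns
  have hpc := (RingObj.wlo_le_cutPos (n := nE P D tc R e) hC hs1 hns).2
  have hpcG : pc P D tc R e < GE P D tc R e := by unfold pc; rw [hG]; omega
  obtain ⟨-, wx, -, -⟩ := RingObj.window_mem_block (n := nE P D tc R e) hXe hs1 hns
  have wX := RingObj.linPos_window (n := nE P D tc R e) hXe hC hs1 hns (X_cut (R := R) hV hD (R.tip e)) ⟨le_rfl, wx⟩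
  have hGpos : 0 < GE P D tc R e := by omega
  refine ⟨hpcG, ?_, ?_, min_le_left _ _, le_max_left _ _, min_le_right _ _, le_max_right _ _⟩
  · calc hs P D tc R e ≤ lp P D tc R e ((X P D (R.tip e)).wlo (nE P D tc R e) P.s (rE P D tc R e)) := min_le_left _ _
      _ ≤ lp P D tc R e ((X P D (R.tip e)).whi (nE P D tc R e) P.s (rE P D tc R e)) := by
          unfold lp GE OParams.Gr; unfold nE at wX; exact wX.1.trans wX.2
      _ ≤ he P D tc R e := le_max_left _ _
  · unfold he lp linPos
    exact max_lt (Nat.mod_lt _ hGpos) (Nat.mod_lt _ hGpos)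

/-- **The exclusion lemma.** For arms `e`, `b` of different colours: if the ring of `b` is higher, every
position of the spoke window of `b` on the ring of `e` reads outside the hull of `e`; if it is lower,
every position of the approach window of `b` on the ring of `e` reads outside the hull of `e`
(`Lanes.lanes_linear` and `RingObj.linPos_lt_of_cyc_lt`). [cite: Nolin2008, §4.3 Prop. 12 (i), Lemma 13 (arXiv 0711.4948: Prop. 11, Lemma 12)] -/
theorem excl (hV : P.Valid) (hD : D.Good P) (htc : ∀ e, tc e < 5) (htgt : D.TgtOK P tc) (hR : R.Good P D tc)
    {e b : Fin 4} (hcol : Slot4.col e ≠ Slot4.col b) :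
    (lv P D tc R e < lv P D tc R b → ∀ p, (X P D (R.tip b)).wlo (nE P D tc R e) P.s (rE P D tc R e) ≤ p →
      p ≤ (X P D (R.tip b)).whi (nE P D tc R e) P.s (rE P D tc R e) → lp P D tc R e p < hs P D tc R e ∨ he P D tc R e < lp P D tc R e p) ∧
    (lv P D tc R b < lv P D tc R e → ∀ p, (Y P tc b).wlo (nE P D tc R e) P.s (rE P D tc R e) ≤ p →
      p ≤ (Y P tc b).whi (nE P D tc R e) P.s (rE P D tc R e) → lp P D tc R e p < hs P D tc R e ∨ he P D tc R e < lp P D tc R e p) := by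
  have heb : e ≠ b := fun h => hcol (h ▸ rfl)
  have hqq : R.q e ≠ R.q b := R.q_ne heb
  have htt : R.tip e ≠ R.tip b := R.tip_ne heb
  have hT : StrictMono (Tq P D R) := strictMono_four hR.hτ.1 hR.hτ.2.1 hR.hτ.2.2
  have hG : StrictMono (Gq P tc R) := strictMono_four hR.hγ.1 hR.hγ.2.1 hR.hγ.2.2
  obtain ⟨l1, l2⟩ := lanes_linear hT hG (Tq_ne_Gq hV hD htc htgt) hqq
  rw [Gq_q] at l1 l2
  change (lv P D tc R e < lv P D tc R b → cyc (12 * P.M) R.c (D.κ P (R.tip b)) < min (cyc (12 * P.M) R.c (D.κ P (R.tip e))) _ ∨ _) at l1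
  change (lv P D tc R b < lv P D tc R e → _) at l2
  rw [Gq_q] at l2
  -- ring data
  obtain ⟨hn1, hns, -, hGE, -⟩ := ringE_facts (D := D) (tc := tc) (R := R) hV e
  have hs1 : 1 ≤ P.s := by have := hV.facts.1; have := hV.facts.2.2.2.2.1; omega
  have hC := C_ok (tc := tc) (R := R) hV hD e
  have hXe := X_ok (tc := tc) (R := R) hV hD (R.tip e) e
  have hXb := X_ok (tc := tc) (R := R) hV hD (R.tip b) e
  have hYe := Y_ok (D := D) (R := R) hV htc e e
  have hYb := Y_ok (D := D) (R := R) hV htc b e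
  have cXe := X_cut (R := R) hV hD (R.tip e)
  have cXb := X_cut (R := R) hV hD (R.tip b)
  have cYe := Y_cut (D := D) (R := R) hV htc htgt e
  have cYb := Y_cut (D := D) (R := R) hV htc htgt b
  have kC : frKey P.M (C P D R).fr (C P D R).lo = R.c := key_C hD hR
  have ρX : ∀ a, (X P D a).lo ≤ D.ξ P a ∧ D.ξ P a ≤ (X P D a).hi := fun a => ⟨le_rfl, le_rfl⟩
  have ρY : ∀ e', (Y P tc e').lo ≤ t P tc e' ∧ t P tc e' ≤ (Y P tc e').hi := fun e' =>
    ⟨le_rfl, by show t P tc e' ≤ t P tc e' + _; exact le_add_of_nonneg_right (by positivity)⟩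
  have kP : ∀ a, frKey P.M (X P D a).fr (D.ξ P a) < 12 * P.M := fun a => by
    have := (hD.κ_range hV a).2; have := hV.ifacts.2.1; have := hV.ifacts.1
    show D.κ P a < _; linarith
  have gP : ∀ e', frKey P.M (Y P tc e').fr (t P tc e') < 12 * P.M := fun e' => by
    obtain ⟨-, -, -, -, -, -, -, g2, hts⟩ := tgt_facts hV htc e'
    have hM : (0 : ℤ) ≤ P.M := by positivity
    have h6 : (Slot4.ts e' : ℤ) ≤ 5 := by omega
    have := hV.ifacts.2.1; have := hV.ifacts.1
    show γ P tc e' < _; nlinarith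
  have wXb := fun p (hp : (X P D (R.tip b)).wlo (nE P D tc R e) P.s (rE P D tc R e) ≤ p ∧ p ≤ (X P D (R.tip b)).whi (nE P D tc R e) P.s (rE P D tc R e)) =>
    RingObj.linPos_window (n := nE P D tc R e) hXb hC hs1 hns cXb hp
  have wYb := fun p (hp : (Y P tc b).wlo (nE P D tc R e) P.s (rE P D tc R e) ≤ p ∧ p ≤ (Y P tc b).whi (nE P D tc R e) P.s (rE P D tc R e)) =>
    RingObj.linPos_window (n := nE P D tc R e) hYb hC hs1 hns cYb hp
  -- the generic step
  have step := fun {A B : RingObj} (hA : A.OK P.s (rE P D tc R e) P.M) (hB : B.OK P.s (rE P D tc R e) P.M)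
      (hsep : RingObj.Sep P.s A B) (cA : RingObj.Before 2 P.s A (C P D R) ∨ RingObj.Before 2 P.s (C P D R) A)
      (cB : RingObj.Before 2 P.s B (C P D R) ∨ RingObj.Before 2 P.s (C P D R) B) {ρA ρB : ℤ}
      (hρA : A.lo ≤ ρA ∧ ρA ≤ A.hi) (hρB : B.lo ≤ ρB ∧ ρB ≤ B.hi) (hPB : frKey P.M B.fr ρB < 12 * P.M)
      (hlt : cyc (12 * P.M) R.c (frKey P.M A.fr ρA) < cyc (12 * P.M) R.c (frKey P.M B.fr ρB)) =>
    RingObj.linPos_lt_of_cyc_lt (n := nE P D tc R e) hA hB hC hs1 hns hsep cA cB hρA hρB hPB (by rw [kC]; exact hlt)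
  unfold lp hs he GE OParams.Gr
  unfold nE at wXb wYb ⊢
  constructor
  · intro hl p hp1 hp2
    have w := wXb p ⟨hp1, hp2⟩
    rcases l1 hl with h | h
    · left
      obtain ⟨h1, h2⟩ := lt_min_iff.1 h
      have w1 := step hXb hXe (sep_XX hV hD (Ne.symm htt)) cXb cXe (ρX _) (ρX _) (kP _) h1
      have w2 := step hXb hYe (sep_XY hV htc htgt _ _) cXb cYe (ρX _) (ρY _) (gP _) h2
      exact lt_of_le_of_lt w.2 (lt_min w1 w2)
    · right
      obtain ⟨h1, h2⟩ := max_lt_iff.1 h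
      have w1 := step hXe hXb (sep_XX hV hD htt) cXe cXb (ρX _) (ρX _) (kP _) h1
      have w2 := step hYe hXb (sep_symm (sep_XY hV htc htgt _ _)) cYe cXb (ρY _) (ρX _) (kP _) h2
      exact lt_of_lt_of_le (max_lt w1 w2) w.1
  · intro hl p hp1 hp2
    have w := wYb p ⟨hp1, hp2⟩
    rcases l2 hl with h | h
    · left
      obtain ⟨h1, h2⟩ := lt_min_iff.1 h
      have w1 := step hYb hXe (sep_symm (sep_XY hV htc htgt _ _)) cYb cXe (ρY _) (ρX _) (kP _) h1
      have w2 := step hYb hYe (sep_YY (Ne.symm heb)) cYb cYe (ρY _) (ρY _) (gP _) h2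
      exact lt_of_le_of_lt w.2 (lt_min w1 w2)
    · right
      obtain ⟨h1, h2⟩ := max_lt_iff.1 h
      have w1 := step hXe hYb (sep_XY hV htc htgt _ _) cXe cYb (ρX _) (ρY _) (gP _) h1
      have w2 := step hYe hYb (sep_YY heb) cYe cYb (ρY _) (ρY _) (gP _) h2
      exact lt_of_lt_of_le (max_lt w1 w2) w.1


/-! ### The routed slot -/

section SlotFields

variable (P D tc R)

/-- Field of the routed slot. [folklore] -/
theorem slot_fr (e : Fin 4) : (slot P D tc R).fr e = D.i (R.tip e) := rfl
/-- Field of the routed slot. [folklore] -/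
theorem slot_lv (e : Fin 4) : (slot P D tc R).lv e = lv P D tc R e := rfl
/-- Field of the routed slot. [folklore] -/
theorem slot_ast (e : Fin 4) : (slot P D tc R).ast e = astE P D tc R e := rfl
/-- Field of the routed slot. [folklore] -/
theorem slot_aln (e : Fin 4) : (slot P D tc R).aln e = alnE P D tc R e := rfl
/-- Field of the routed slot. [folklore] -/
theorem slot_k (e : Fin 4) : (slot P D tc R).k P e = D.k P (R.tip e) := rfl
/-- Field of the routed slot. [folklore] -/
theorem slot_T (e : Fin 4) : (slot P D tc R).T P e = D.T P (R.tip e) := rfl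
/-- Field of the routed slot. [folklore] -/
theorem slot_ξ (e : Fin 4) : (slot P D tc R).ξ P e = D.ξ P (R.tip e) := rfl
/-- Field of the routed slot. [folklore] -/
theorem slot_t (e : Fin 4) : (slot P D tc R).t P e = t P tc e := rfl
/-- Field of the routed slot. [folklore] -/
theorem slot_nr (e : Fin 4) : (slot P D tc R).nr P e = nE P D tc R e := rfl
/-- Field of the routed slot. [folklore] -/
theorem slot_r (e : Fin 4) : (slot P D tc R).r P e = rE P D tc R e := rfl
/-- Field of the routed slot. [folklore] -/
theorem slot_G (e : Fin 4) : (slot P D tc R).G P e = GE P D tc R e := rfl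
/-- Field of the routed slot. [folklore] -/
theorem slot_toView (e : Fin 4) (p : ℕ) :
    (slot P D tc R).toView P e p = (p + GE P D tc R e - shE P D tc R e) % GE P D tc R e := rfl
/-- Field of the routed slot. [folklore] -/
theorem slot_runLo (e : Fin 4) : (slot P D tc R).runLo P e =
    min (piecePos (nE P D tc R e) (Slot4.bs e) (latIdx P.s (rE P D tc R e) (t P tc e)))
      (piecePos (nE P D tc R e) (Slot4.bs e) (latIdx P.s (rE P D tc R e) (t P tc e) + P.d)) := rfl
/-- Field of the routed slot. [folklore] -/
theorem slot_runHi (e : Fin 4) : (slot P D tc R).runHi P e =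
    max (piecePos (nE P D tc R e) (Slot4.bs e) (latIdx P.s (rE P D tc R e) (t P tc e)))
      (piecePos (nE P D tc R e) (Slot4.bs e) (latIdx P.s (rE P D tc R e) (t P tc e) + P.d)) := rfl
/-- Field of the routed slot. [folklore] -/
theorem slot_spokeWinLo (b e : Fin 4) : (slot P D tc R).spokeWinLo P b e =
    blockOff (nE P D tc R e) (D.i (R.tip b)) +
      (if D.i (R.tip b) % 3 = 2 then 2 * (nE P D tc R e - 2 - latIdx P.s (rE P D tc R e) (D.ξ P (R.tip b)))
        else 2 * (latIdx P.s (rE P D tc R e) (D.ξ P (R.tip b)) - 1)) := rfl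
/-- Field of the routed slot. [folklore] -/
theorem slot_apprWinLo (b e : Fin 4) : (slot P D tc R).apprWinLo P b e =
    min (piecePos (nE P D tc R e) (Slot4.ts b) (latIdx P.s (rE P D tc R e) (t P tc b) - 1))
      (piecePos (nE P D tc R e) (Slot4.ts b) (latIdx P.s (rE P D tc R e) (t P tc b + (P.N' / 64 : ℕ)) + 1)) := rfl
/-- Field of the routed slot. [folklore] -/
theorem slot_apprWinHi (b e : Fin 4) : (slot P D tc R).apprWinHi P b e =
    max (piecePos (nE P D tc R e) (Slot4.ts b) (latIdx P.s (rE P D tc R e) (t P tc b) - 1))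
      (piecePos (nE P D tc R e) (Slot4.ts b) (latIdx P.s (rE P D tc R e) (t P tc b + (P.N' / 64 : ℕ)) + 1)) + 1 := rfl
/-- Field of the routed slot. [folklore] -/
theorem slot_pE (e : Fin 4) : (slot P D tc R).pE P e =
    piecePos (nE P D tc R e) (if 2 ≤ (e : ℕ) then (D.i (R.tip e) + 3) % 6 else D.i (R.tip e))
      (latIdx P.s (rE P D tc R e) (D.ξ P (R.tip e))) := rfl

end SlotFields

/-- The entry piece of the routed slot is the piece of the spoke row, seen in the reading configuration. [folklore] -/
theorem pE_eq (hV : P.Valid) (hD : D.Good P) (e : Fin 4) :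
    (slot P D tc R).pE P e = ((X P D (R.tip e)).cutPos (nE P D tc R e) P.s (rE P D tc R e) + GE P D tc R e - shE P D tc R e) % GE P D tc R e := by
  obtain ⟨hn1, hns, -, hG, -⟩ := ringE_facts (D := D) (tc := tc) (R := R) hV e
  have hs1 : 1 ≤ P.s := by have := hV.facts.1; have := hV.facts.2.2.2.2.1; omega
  have hX := X_ok (tc := tc) (R := R) hV hD (R.tip e) e
  obtain ⟨-, -, x3⟩ := hX.idx hs1 hns
  have hι : latIdx P.s (rE P D tc R e) (D.ξ P (R.tip e)) < nE P D tc R e := by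
    change latIdx P.s (rE P D tc R e) (D.ξ P (R.tip e)) + 4 < nE P D tc R e at x3; omega
  rw [slot_pE]
  show _ = (piecePos (nE P D tc R e) (D.i (R.tip e)) (latIdx P.s (rE P D tc R e) (D.ξ P (R.tip e))) + GE P D tc R e - shE P D tc R e) % GE P D tc R e
  unfold shE
  by_cases h2 : 2 ≤ (e : ℕ)
  · rw [if_pos h2, if_pos h2, hG]
    exact piecePos_frame_add_three hn1 (hD.hi _) hι
  · rw [if_neg h2, if_neg h2, Nat.sub_zero, Nat.add_mod_right, Nat.mod_eq_of_lt]
    rw [hG]; exact piecePos_lt hn1 (hD.hi _) hι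

/-- **The routed slot satisfies the routing predicate.** [cite: Nolin2008, §4.3 Prop. 12 (i), Lemma 13 and §4.4 p. 12 (arXiv 0711.4948: Prop. 11, Lemma 12; proof of Thm. 10)] -/
theorem routeOK_slot (hV : P.Valid) (hD : D.Good P) (htc : ∀ e, tc e < 5) (htgt : D.TgtOK P tc) (hR : R.Good P D tc) :
    Slot4.RouteOK P (slot P D tc R) := by
  have hs1 : 1 ≤ P.s := by have := hV.facts.1; have := hV.facts.2.2.2.2.1; omega
  have HF := fun e => hull_facts (tc := tc) (R := R) hV hD e
  have RF := fun e => ringE_facts (D := D) (tc := tc) (R := R) hV e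
  have shG : ∀ e, shE P D tc R e ≤ GE P D tc R e := fun e => by
    obtain ⟨hn1, -, -, hG, -⟩ := RF e; unfold shE; rw [hG]; split_ifs <;> omega
  have hAG : ∀ e, astAbs P D tc R e < GE P D tc R e := fun e => by
    obtain ⟨hpcG, -⟩ := HF e; unfold astAbs; exact Nat.mod_lt _ (by omega)
  -- membership in the hull arc, from a read position
  have memArc : ∀ e p, p < GE P D tc R e → hs P D tc R e ≤ lp P D tc R e p → lp P D tc R e p ≤ he P D tc R e →
      InArc (GE P D tc R e) (astE P D tc R e) (alnE P D tc R e) ((p + GE P D tc R e - shE P D tc R e) % GE P D tc R e) := by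
    intro e p hpG h1 h2
    obtain ⟨hpcG, hshe, hheG, -⟩ := HF e
    unfold astE
    rw [inArc_rot (hAG e) hpG (shG e)]
    unfold astAbs alnE
    rw [inArc_hull_iff hpcG hpG hshe hheG]
    exact ⟨h1, h2⟩
  have notMemArc : ∀ e p, p < GE P D tc R e → (lp P D tc R e p < hs P D tc R e ∨ he P D tc R e < lp P D tc R e p) →
      ¬ InArc (GE P D tc R e) (astE P D tc R e) (alnE P D tc R e) ((p + GE P D tc R e - shE P D tc R e) % GE P D tc R e) := by
    intro e p hpG h
    obtain ⟨hpcG, hshe, hheG, -⟩ := HF e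
    unfold astE
    rw [inArc_rot (hAG e) hpG (shG e)]
    unfold astAbs alnE
    rw [inArc_hull_iff hpcG hpG hshe hheG]
    unfold lp at h
    omega
  unfold Slot4.RouteOK
  simp only [slot_ast, slot_aln, slot_G, slot_lv, slot_runLo, slot_runHi, slot_toView, slot_spokeWinLo, slot_apprWinLo,
    slot_apprWinHi, slot_nr, slot_fr, slot_ξ, slot_t, slot_T, slot_k, pE_eq hV hD]
  refine ⟨fun e => ?_, fun e b heb h => R.q_ne heb (laneLevel_injective _ _ h), fun e => ?_, fun e p hpG hlo hhi => ?_,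
    fun e b hcol hl q₀ hq₀ => ?_, fun e b hcol hl p hp12 hlo hhi => ?_, fun e b _ hfr => htgt.out b (R.tip e) hfr, fun e b hcol hfr => ?_⟩
  · -- (a) the arc is a genuine arc of the ring
    obtain ⟨hpcG, hshe, hheG, -⟩ := HF e
    have hGpos : 0 < GE P D tc R e := by omega
    unfold astE alnE
    exact ⟨Nat.mod_lt _ hGpos, by omega, by omega⟩
  · -- (c) the entry piece is on the arc
    obtain ⟨hn1, hns, -, hG, -⟩ := RF e
    obtain ⟨-, -, -, h1, h2, -, -⟩ := HF e
    have hX := X_ok (tc := tc) (R := R) hV hD (R.tip e) e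
    have hC := C_ok (tc := tc) (R := R) hV hD e
    have pXw := RingObj.wlo_le_cutPos (n := nE P D tc R e) hX hs1 hns
    obtain ⟨-, -, bx, ex⟩ := RingObj.window_mem_block (n := nE P D tc R e) hX hs1 hns
    have w := RingObj.linPos_window (n := nE P D tc R e) hX hC hs1 hns (X_cut (R := R) hV hD (R.tip e)) ⟨pXw.1, by omega⟩
    refine memArc e _ (by rw [hG]; omega) ?_ ?_
    · unfold lp GE OParams.Gr pc; unfold lp GE OParams.Gr pc at h1; unfold nE at w h1 ⊢; exact h1.trans w.1
    · unfold lp GE OParams.Gr pc; unfold lp GE OParams.Gr pc at h2; unfold nE at w h2 ⊢; exact w.2.trans h2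
  · -- (d) the exit run is on the arc
    obtain ⟨hn1, hns, -, hG, -⟩ := RF e
    obtain ⟨-, -, -, -, -, h3, h4⟩ := HF e
    have hY := Y_ok (D := D) (R := R) hV htc e e
    have hC := C_ok (tc := tc) (R := R) hV hD e
    obtain ⟨y1, y2, y3⟩ := hY.idx hs1 hns
    obtain ⟨-, -, byy, ey⟩ := RingObj.window_mem_block (n := nE P D tc R e) hY hs1 hns
    have hlo' : -(rE P D tc R e : ℤ) ≤ t P tc e := by
      have h := hY.hlo; have hMr : (2 * P.M : ℤ) ≤ rE P D tc R e := by exact_mod_cast hY.hMr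
      change _ ≤ t P tc e at h; have : (0 : ℤ) ≤ P.s := by positivity
      linarith
    have hhi_idx : latIdx P.s (rE P D tc R e) (Y P tc e).hi = latIdx P.s (rE P D tc R e) (t P tc e) + (P.d - 1) :=
      latIdx_row_add_mul hs1 hlo' (P.d - 1)
    have hd1 : 1 ≤ P.d := by unfold OParams.d; generalize P.N' / 64 / P.s = x; omega
    change 2 ≤ latIdx P.s (rE P D tc R e) (t P tc e) at y1
    change latIdx P.s (rE P D tc R e) (t P tc e) ≤ _ at y2
    rw [hhi_idx] at y3
    have wa := RingObj.piecePos_mem_window (n := nE P D tc R e) hY hs1 hns (ι := latIdx P.s (rE P D tc R e) (t P tc e))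
      (by change latIdx _ _ (t P tc e) - 1 ≤ _; omega) (by rw [hhi_idx]; omega)
    have wb := RingObj.piecePos_mem_window (n := nE P D tc R e) hY hs1 hns (ι := latIdx P.s (rE P D tc R e) (t P tc e) + P.d)
      (by change latIdx _ _ (t P tc e) - 1 ≤ _; omega) (by rw [hhi_idx]; omega)
    have ea := piecePos_ts e hn1 (ι := latIdx P.s (rE P D tc R e) (t P tc e)) (by omega)
    have eb := piecePos_ts e hn1 (ι := latIdx P.s (rE P D tc R e) (t P tc e) + P.d) (by omega)
    have esh : shE P D tc R e = (if 2 ≤ (e : ℕ) then 6 * nE P D tc R e - 2 else 0) := rfl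
    rw [← esh] at ea eb
    change (Y P tc e).wlo (nE P D tc R e) P.s (rE P D tc R e) ≤ piecePos (nE P D tc R e) (Slot4.ts e) _ ∧
      piecePos (nE P D tc R e) (Slot4.ts e) _ + 1 ≤ (Y P tc e).whi (nE P D tc R e) P.s (rE P D tc R e) at wa
    change (Y P tc e).wlo (nE P D tc R e) P.s (rE P D tc R e) ≤ piecePos (nE P D tc R e) (Slot4.ts e) _ ∧
      piecePos (nE P D tc R e) (Slot4.ts e) _ + 1 ≤ (Y P tc e).whi (nE P D tc R e) P.s (rE P D tc R e) at wb
    rw [ea] at wa; rw [eb] at wb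
    have hp' : (Y P tc e).wlo (nE P D tc R e) P.s (rE P D tc R e) ≤ p + shE P D tc R e ∧
        p + shE P D tc R e ≤ (Y P tc e).whi (nE P D tc R e) P.s (rE P D tc R e) := by
      constructor <;> omega
    have hp'G : p + shE P D tc R e < GE P D tc R e := by rw [hG]; omega
    have w := RingObj.linPos_window (n := nE P D tc R e) hY hC hs1 hns (Y_cut (D := D) (R := R) hV htc htgt e) hp'
    have key : p = (p + shE P D tc R e + GE P D tc R e - shE P D tc R e) % GE P D tc R e := by
      rw [show p + shE P D tc R e + GE P D tc R e - shE P D tc R e = p + GE P D tc R e by omega, Nat.add_mod_right,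
        Nat.mod_eq_of_lt hpG]
    rw [key]
    refine memArc e _ hp'G ?_ ?_
    · unfold lp GE OParams.Gr pc; unfold lp GE OParams.Gr pc at h3; unfold nE at w h3 ⊢; exact h3.trans w.1
    · unfold lp GE OParams.Gr pc; unfold lp GE OParams.Gr pc at h4; unfold nE at w h4 ⊢; exact w.2.trans h4
  · -- (e) the spoke windows of the other colour, higher rings, are off the arc
    obtain ⟨hn1, hns, -, hG, -⟩ := RF e
    have hXb := X_ok (tc := tc) (R := R) hV hD (R.tip b) e
    obtain ⟨x1, -, x3⟩ := hXb.idx hs1 hns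
    obtain ⟨-, -, bx, ex⟩ := RingObj.window_mem_block (n := nE P D tc R e) hXb hs1 hns
    change 2 ≤ latIdx P.s (rE P D tc R e) (D.ξ P (R.tip b)) at x1
    change latIdx P.s (rE P D tc R e) (D.ξ P (R.tip b)) + 4 < nE P D tc R e at x3
    set ι := latIdx P.s (rE P D tc R e) (D.ξ P (R.tip b)) with hι
    set p := blockOff (nE P D tc R e) (D.i (R.tip b)) +
        (if D.i (R.tip b) % 3 = 2 then 2 * (nE P D tc R e - 2 - ι) else 2 * (ι - 1)) + q₀ with hp_def
    have hpw : (X P D (R.tip b)).wlo (nE P D tc R e) P.s (rE P D tc R e) ≤ p ∧ p ≤ (X P D (R.tip b)).whi (nE P D tc R e) P.s (rE P D tc R e) := by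
      unfold RingObj.wlo RingObj.whi
      change min (piecePos (nE P D tc R e) (D.i (R.tip b)) (ι - 1)) (piecePos (nE P D tc R e) (D.i (R.tip b)) (ι + 1)) ≤ p ∧
        p ≤ max (piecePos (nE P D tc R e) (D.i (R.tip b)) (ι - 1)) (piecePos (nE P D tc R e) (D.i (R.tip b)) (ι + 1)) + 1
      by_cases h2 : D.i (R.tip b) % 3 = 2
      · rw [if_pos h2] at hp_def; rw [piecePos_eq_of_two h2, piecePos_eq_of_two h2]; constructor <;> omega
      · rw [if_neg h2] at hp_def; rw [piecePos_eq_of_ne h2, piecePos_eq_of_ne h2]; constructor <;> omega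
    have hpG : p < GE P D tc R e := by rw [hG]; omega
    exact notMemArc e p hpG ((excl hV hD htc htgt hR hcol).1 hl p hpw.1 hpw.2)
  · -- (f) the approach windows of the other colour, lower rings, are off the arc
    obtain ⟨hn1, hns, -, hG, -⟩ := RF e
    have hYb := Y_ok (D := D) (R := R) hV htc b e
    obtain ⟨y1, y2, y3⟩ := hYb.idx hs1 hns
    obtain ⟨-, -, byy, ey⟩ := RingObj.window_mem_block (n := nE P D tc R e) hYb hs1 hns
    obtain ⟨-, -, hd1, -⟩ := tgt_facts hV htc b
    have hm1 : latIdx P.s (rE P D tc R e) (t P tc b) ≤ latIdx P.s (rE P D tc R e) (t P tc b + (P.N' / 64 : ℕ)) :=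
      latIdx_mono (by have : (0 : ℤ) ≤ ((P.N' / 64 : ℕ) : ℤ) := by positivity
                      linarith)
    have hm2 : latIdx P.s (rE P D tc R e) (t P tc b + (P.N' / 64 : ℕ)) ≤ latIdx P.s (rE P D tc R e) (Y P tc b).hi :=
      latIdx_mono (by change _ ≤ t P tc b + _; linarith)
    change 2 ≤ latIdx P.s (rE P D tc R e) (t P tc b) at y1
    change latIdx P.s (rE P D tc R e) (t P tc b) ≤ _ at y2
    have wa := RingObj.piecePos_mem_window (n := nE P D tc R e) hYb hs1 hns (ι := latIdx P.s (rE P D tc R e) (t P tc b) - 1) le_rfl (by omega)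
    have wb := RingObj.piecePos_mem_window (n := nE P D tc R e) hYb hs1 hns (ι := latIdx P.s (rE P D tc R e) (t P tc b + (P.N' / 64 : ℕ)) + 1)
      (by change latIdx _ _ (t P tc b) - 1 ≤ _; omega) (by omega)
    change (Y P tc b).wlo (nE P D tc R e) P.s (rE P D tc R e) ≤ piecePos (nE P D tc R e) (Slot4.ts b) _ ∧
      piecePos (nE P D tc R e) (Slot4.ts b) _ + 1 ≤ (Y P tc b).whi (nE P D tc R e) P.s (rE P D tc R e) at wa
    change (Y P tc b).wlo (nE P D tc R e) P.s (rE P D tc R e) ≤ piecePos (nE P D tc R e) (Slot4.ts b) _ ∧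
      piecePos (nE P D tc R e) (Slot4.ts b) _ + 1 ≤ (Y P tc b).whi (nE P D tc R e) P.s (rE P D tc R e) at wb
    have hpw : (Y P tc b).wlo (nE P D tc R e) P.s (rE P D tc R e) ≤ p ∧ p ≤ (Y P tc b).whi (nE P D tc R e) P.s (rE P D tc R e) := by
      constructor <;> omega
    have hpG : p < GE P D tc R e := by rw [hG]; omega
    exact notMemArc e p hpG ((excl hV hD htc htgt hR hcol).2 hl p hpw.1 hpw.2)
  · -- (h) tips of different colours on a common frame
    have hpar := hR.tip_parity_ne hcol
    rcases lt_trichotomy (D.ζ (R.tip e)) (D.ζ (R.tip b)) with h | h | h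
    · exact Or.inl (hD.gap_of_diff hV hpar hfr h).2
    · exact absurd h (hD.zeta_ne hV (R.tip_ne (fun h' => hcol (h' ▸ rfl))) hfr)
    · exact Or.inr (hD.gap_of_diff hV (Ne.symm hpar) hfr.symm h).2

/-- **The routed slot is one of the finitely many slots.** [folklore] -/
theorem slot_mem_slot4Finset (hV : P.Valid) (hD : D.Good P) (htc : ∀ e, tc e < 5) :
    slot P D tc R ∈ slot4Finset P := by
  rw [mem_slot4Finset]
  intro q e
  obtain ⟨hpcG, hshe, hheG, -⟩ := hull_facts (tc := tc) (R := R) hV hD e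
  obtain ⟨hn1, -, -, hG, hn7, hlv⟩ := ringE_facts (D := D) (tc := tc) (R := R) hV e
  have hGpos : 0 < GE P D tc R e := by omega
  have hG7 : GE P D tc R e ≤ P.Gr 7 := by rw [hG]; unfold OParams.Gr; omega
  fin_cases q
  · exact hD.hi _
  · exact hD.hj _
  · exact hD.hν _
  · exact htc e
  · exact hlv
  · show astE P D tc R e < P.Gr 7 + 1
    have : astE P D tc R e < GE P D tc R e := Nat.mod_lt _ hGpos
    omega
  · show alnE P D tc R e < P.Gr 7 + 1
    unfold alnE; omega


end TipData

end Literature.Probability.Percolation
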